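import Literature.MathematicalPhysics.QuantumLattice.FermiRG.BGM2003SectorPropagatorDecayProof
import HarnessLib

/-!
# Benfatto–Giuliani–Mastropietro 2003, Lemma 6.1 [lm7.1] (7.11): the dimensional bound for the jellium sector
# propagator with the interpolated operators `D₁(t)`, `D₂(t)` — PROOF (`lemma61_jelliumPropagatorDecay_holds`)

Topic `Literature/MathematicalPhysics/QuantumLattice/FermiRG`; theorem-and-construction companion (seat t3) of the
statement file `BGM2003SectorPropagators.lean` (F3c), whose CLOSED NAMED FACT
`BGM2003.lemma61_jelliumPropagatorDecay` (BGM 2003 §6 Lemma 6.1 [lm7.1] (7.11)) is DISCHARGED here: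
`theorem lemma61_jelliumPropagatorDecay_holds : lemma61_jelliumPropagatorDecay`.  With part 3 of the Lemma 2.1
companion (`lemma21_sectorPropagatorDecay_holds`) this makes F3c fact-free.  Nothing of F3a–F3d or of the Lemma 2.1
companions (`BGM2003SectorPropagatorDecay{Frame,Master,Proof}.lean`) is edited or restated; they are IMPORTED and
their machine (Fermi frame, anisotropic chart, smooth shell bump, master function, oscillatory integrals, change of
variables) is re-used by name.  No new named fact is introduced (D-0026).

* G. Benfatto, A. Giuliani, V. Mastropietro, *Low temperature analysis of two-dimensional Fermi systems with
  symmetric Fermi surface*, Ann. Henri Poincaré 4 (2003) 137–193, arXiv:cond-mat/0207210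
  [BenfattoGiulianiMastropietro2003]; locators `p.N (Ln)` = N-th 3000-character chunk (line n) of the materialised
  arXiv TeX.  §6 «The rotation-invariant case» p.25: the jellium model `ε(k⃗) = |k⃗|²/2m` (L8–12), the
  interpolation `ρ(t) = √((tk'₁ + p_F)² + (tk'₂)²)` of (7.2) (L36–49, «recalling that now `e⃗_r(θ) = n⃗(θ)` and
  `e⃗_t(θ) = τ⃗(θ)`»), the operators `D₁(t)`, `D₂(t)` (7.5) (L80–90), Lemma 6.1 (7.11) (L114–127: «It is easy to
  prove the following dimensional bound») and the Remark (L129–136: «Each operator `D_i(t)` improves the bound of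
  the covariance by a factor at least `γ^h` … This is a consequence of rotational invariance»); §1.2 p.4 (L130–135):
  «Among the dispersion relations which are in the class we are considering is … that of the jellium model».

## The printed statement and the route

(7.11): `|∂₀^{n₀} D₁^{n₁} D₂^{n₂} g^{(h)}_ω(x)| ≤ C_{N,m} γ^{h(3/2 + n₀ + n₁ + 3n₂/2)} / (1 + [(γ^hx₀)² + (γ^hx₁)² + (γ^{h/2}x₂)²]^N)`,
`D_iⁿ` the product of `n` factors `D_i(t_j)`; typed in F3c with the multipliers (7.5) inserted under the
`k`-integral of (3.20) (`jelliumPropagatorD`, `dMultiplier₁/₂`).  The paper gives no separate proof («easy»); the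
proof is the one of Lemma 2.1 (§7.2: smooth symbol in the anisotropic chart, integration by parts) plus the
observation of the Remark.  Accordingly:

* **§J (the jellium datum is in the class of §1.2).** `DispersionHyp (jelliumDispersion m) μ e₀ (jelliumRadius m μ)`
  for `m > 0`, `0 < e₀ < μ` (`jellium_dispersionHyp`: `u = √(2m(μ+e))` smooth on `𝕋¹ × (−e₁, e₁)`, `e₁ = (e₀+μ)/2`;
  `u ≥ √(2m(μ−e₀))`; `ε(u e⃗_r) = μ + e`; curvature `1/u`; radial slope `u/m`; even), and the jellium frame
  `n⃗ = e⃗_r`, `τ⃗ = e⃗_t`, `p⃗_F = p_F e⃗_r`, so that part 2's frame coordinates are the `k'₁, k'₂` of (7.5)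
  (`frameCoord₁_jellium`, `frameCoord₂_jellium`).
* **§M (the multipliers in the chart — the Remark).** On a sector, `ρ(t)² = |t k⃗ + (1−t)p⃗_F(θ_{h,ω})|² ≥ m(μ−e₀)/4`
  for `t ∈ [0,1]` (`dRho_lower_of_mem_sSector`: the angular aperture of the tree's `ζ_{h,ω}` is `3w_h/4 ≤ 3π/4`, so
  the interpolation (7.2) stays away from the origin); hence with `k'₁ = s²a`, `k'₂ = sb` (`s = γ^{h/2} = 2^{-n}`)
  `m₁(t,k⃗) = s²·M₁(a,b,t,s)`, `m₂(t,k⃗) = s³·M₂(a,b,t,s)` with `M_i` = polynomial × `η(ρ²)` SMOOTH on all of `ℝ⁴`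
  (`rMult₁/₂`, `η` = the tree's `sectorInvCutoff`, `= 1/ρ²` on the support) — the gains `γ^h` per `D₁` and
  `γ^{3h/2}` per `D₂`.
* **§S (the `D`-weighted symbol and its master function).** `S^D = S_{(n₀,0,0)} · Π_j(i m₁(t_j)) Π_j(i m₂(s_j))`
  (`wSymbolD`, part 2's `wSymbol`), its chart form `R^D` (`rescaledWSymbolD`), the scale factor
  `scaleFactor n n₀ 0 0 · (s²)^{n₁}(s³)^{n₂}` (`scaleFactorD`), the master function `Ψ^D = Ψ_{(n₀,0,0)} · Π(iM₁) Π(iM₂)`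
  jointly smooth on `(ℝ² × (ℝ^{n₁} × ℝ^{n₂})) × ℝ³` (`masterDL`, `contDiff_masterDL`), the identity
  `R^D = scaleFactorD · Ψ^D((θ_{h,σ}, 2^{-n}), (t⃗, s⃗); ·)` for `t_j, s_j ∈ [0,1]` (`rescaledWSymbolD_eq_smul_masterDL`),
  the support box (part 2's, F3b's Lemma 7.3), and `h`- AND `t`-uniform `C^k` bounds by continuity on the COMPACT
  `[0,2π] × [0,1] × [0,1]^{n₁} × [0,1]^{n₂} × box` (`exists_norm_iteratedFDeriv_rescaledWSymbolD_le`).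
* **§A–§C (assembly).** `D₁^{n₁}D₂^{n₂}g^{(h)}_ω(x₀, x₁e⃗_r + x₂e⃗_t) = Φ_{(2π)^{-3}S^D_{0}}` and `∂₀^{n₀}` under the
  integral (part 3's `iteratedDeriv_oscInt`), the affine change of variables and the decay transfer (part 3's chart,
  `Analysis/Fourier/FourierLinearChange`), Fourier decay at order `2N` from the uniform bounds
  (`Analysis/Fourier/FourierDecayFromDerivBounds`), `γ^hγ^hγ^{h/2}·scaleFactorD = γ^{h(3/2+n₀+n₁+3n₂/2)}`
  (`det_mul_scaleFactorD`), and `1 + [Σ squares]^N ≤ 1 + (Σ moduli)^{2N}` for the printed denominator.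

Everything here is PROVED; the definitions (`dRhoSq`, `dCore`, `rMult₁`, `rMult₂`, `dQ₀`, `wSymbolD`,
`rescaledWSymbolD`, `scaleFactorD`, `masterDL`) are technical constructions of the proof with bodies, cited to
the step of the paper they serve.  Nothing is asserted about the Hubbard model, H1, K1 or K3.
-/

noncomputable section

open Real Set Complex Function Filter MeasureTheory Metric
open scoped Topology ContDiff ComplexConjugate FourierTransform InnerProductSpace ENNReal
open Literature.Analysis.Calculus Literature.Analysis.SpecialFunctions Literature.Analysis.Fourier

namespace Literature.MathematicalPhysics.QuantumLattice.FermiRG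

/-- `e⃗_t(θ)₀ = -sin θ`. [folklore] -/
@[simp] private theorem tdir_apply_zero' (θ : ℝ) : tdir θ 0 = -Real.sin θ := rfl

/-- `e⃗_t(θ)₁ = cos θ`. [folklore] -/
@[simp] private theorem tdir_apply_one' (θ : ℝ) : tdir θ 1 = Real.cos θ := rfl

namespace BGM2003

/-! ### §J. The jellium datum `ε = |k⃗|²/2m`, `u(θ,e) = √(2m(μ+e))` satisfies the hypotheses of §1.2 -/

section Jellium

variable {m μ e₀ : ℝ}

/-- `u(θ,e) = √(2m(μ+e)) ≥ 0`. [cite: BenfattoGiulianiMastropietro2003, §6 p.25 (L8–12)] -/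
theorem jelliumRadius_nonneg (m μ θ e : ℝ) : 0 ≤ jelliumRadius m μ θ e := Real.sqrt_nonneg _

/-- `u(θ,e)² = 2m(μ+e)` for `μ + e ≥ 0`, `m ≥ 0`. [cite: BenfattoGiulianiMastropietro2003, §6 p.25 (L8–12)] -/
theorem jelliumRadius_sq (hm : 0 ≤ m) {e : ℝ} (h : 0 ≤ μ + e) (θ : ℝ) :
    jelliumRadius m μ θ e ^ 2 = 2 * m * (μ + e) :=
  Real.sq_sqrt (by positivity)

/-- `u(θ,e) > 0` for `μ + e > 0`, `m > 0`. [cite: BenfattoGiulianiMastropietro2003, §6 p.25 (L8–12)] -/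
theorem jelliumRadius_pos (hm : 0 < m) {e : ℝ} (h : 0 < μ + e) (θ : ℝ) : 0 < jelliumRadius m μ θ e :=
  Real.sqrt_pos.2 (by positivity)

/-- `u` does not depend on `θ`: `u' = 0` (rotation invariance). [cite: BenfattoGiulianiMastropietro2003, §6 p.25 (L8–12)] -/
@[simp] theorem radiusDeriv_jelliumRadius (m μ θ e : ℝ) : radiusDeriv (jelliumRadius m μ) θ e = 0 := by
  simp [radiusDeriv, jelliumRadius]

/-- `u'' = 0`. [cite: BenfattoGiulianiMastropietro2003, §6 p.25 (L8–12)] -/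
@[simp] theorem radiusDeriv₂_jelliumRadius (m μ θ e : ℝ) : radiusDeriv₂ (jelliumRadius m μ) θ e = 0 := by
  unfold radiusDeriv₂
  simp

/-- `s'(θ,e) = u(θ,e)` for the circle. [cite: BenfattoGiulianiMastropietro2003, §7.1 (A1.6) p.26 (L41)] -/
@[simp] theorem speed_jelliumRadius (m μ θ e : ℝ) : speed (jelliumRadius m μ) θ e = jelliumRadius m μ θ e := by
  rw [speed, radiusDeriv_jelliumRadius]
  simp [Real.sqrt_sq (jelliumRadius_nonneg m μ θ e)]

/-- The curvature of the circle `Σ(e)` is `1/u(θ,e)`. [cite: BenfattoGiulianiMastropietro2003, §7.1 (A1.7) p.26 (L51)] -/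
theorem curvature_jelliumRadius (hm : 0 < m) {e : ℝ} (h : 0 < μ + e) (θ : ℝ) :
    curvature (jelliumRadius m μ) θ e = (jelliumRadius m μ θ e)⁻¹ := by
  have hu := jelliumRadius_pos hm h θ
  rw [curvature, speed_jelliumRadius, radiusDeriv_jelliumRadius, radiusDeriv₂_jelliumRadius]
  field_simp
  ring

/-- **`n⃗(θ) = e⃗_r(θ)`** for the jellium model (p.25 L45–48: «recalling that now `e⃗_r(θ) = n⃗(θ)`»).
[cite: BenfattoGiulianiMastropietro2003, §6 p.25 (L45–48)] -/
theorem unitNormal_jelliumRadius (hm : 0 < m) {e : ℝ} (h : 0 < μ + e) (θ : ℝ) :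
    unitNormal (jelliumRadius m μ) θ e = dir θ := by
  have hu := jelliumRadius_pos hm h θ
  rw [unitNormal, speed_jelliumRadius, radiusDeriv_jelliumRadius, zero_smul, sub_zero, smul_smul,
    inv_mul_cancel₀ hu.ne', one_smul]

/-- **`τ⃗(θ) = e⃗_t(θ)`** for the jellium model (p.25 L45–48: «and `e⃗_t(θ) = τ⃗(θ)`»).
[cite: BenfattoGiulianiMastropietro2003, §6 p.25 (L45–48)] -/
theorem unitTangent_jelliumRadius (hm : 0 < m) {e : ℝ} (h : 0 < μ + e) (θ : ℝ) :
    unitTangent (jelliumRadius m μ) θ e = tdir θ := by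
  have hu := jelliumRadius_pos hm h θ
  rw [unitTangent, speed_jelliumRadius, radiusDeriv_jelliumRadius, zero_smul, zero_add, smul_smul,
    inv_mul_cancel₀ hu.ne', one_smul]

/-- `ε(k⃗) = |k⃗|²/2m` is smooth. [cite: BenfattoGiulianiMastropietro2003, §6 p.25 (L8–10)] -/
theorem contDiff_jelliumDispersion (m : ℝ) {n : WithTop ℕ∞} : ContDiff ℝ n (jelliumDispersion m) := by
  unfold jelliumDispersion
  exact (((contDiff_apply ℝ ℝ 0).pow 2).add ((contDiff_apply ℝ ℝ 1).pow 2)).div_const _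

/-- The gradient of `ε(k⃗) = |k⃗|²/2m`: `∇ε(k⃗)·v⃗ = k⃗·v⃗/m`. [cite: BenfattoGiulianiMastropietro2003, §6 p.25 (L8–10)] -/
theorem hasFDerivAt_jelliumDispersion (m : ℝ) (k : Fin 2 → ℝ) :
    HasFDerivAt (jelliumDispersion m)
      (((2 * m)⁻¹ * (2 * k 0)) • ContinuousLinearMap.proj (R := ℝ) (φ := fun _ : Fin 2 => ℝ) 0 +
        ((2 * m)⁻¹ * (2 * k 1)) • ContinuousLinearMap.proj (R := ℝ) (φ := fun _ : Fin 2 => ℝ) 1) k := by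
  have h0 := hasFDerivAt_apply (𝕜 := ℝ) (0 : Fin 2) k
  have h1 := hasFDerivAt_apply (𝕜 := ℝ) (1 : Fin 2) k
  have hfun : jelliumDispersion m = fun k : Fin 2 → ℝ => (k 0 * k 0 + k 1 * k 1) * (2 * m)⁻¹ := by
    funext k; simp [jelliumDispersion, div_eq_mul_inv, pow_two]
  rw [hfun]
  refine (((h0.mul h0).add (h1.mul h1)).mul_const _).congr_fderiv ?_
  ext v
  simp only [FunLike.coe_add, FunLike.coe_smul, Pi.add_apply, Pi.smul_apply, ContinuousLinearMap.proj_apply,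
    smul_eq_mul]
  ring

/-- `∇ε(k⃗)·v⃗ = (k₀v₀ + k₁v₁)/m`. [cite: BenfattoGiulianiMastropietro2003, §6 p.25 (L8–10)] -/
theorem fderiv_jelliumDispersion (hm : m ≠ 0) (k v : Fin 2 → ℝ) :
    fderiv ℝ (jelliumDispersion m) k v = (k 0 * v 0 + k 1 * v 1) / m := by
  rw [(hasFDerivAt_jelliumDispersion m k).fderiv]
  simp only [FunLike.coe_add, FunLike.coe_smul, Pi.add_apply, Pi.smul_apply, ContinuousLinearMap.proj_apply,
    smul_eq_mul]
  field_simp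

/-- The radial derivative on `Σ(e)`: `∇ε(u e⃗_r)·e⃗_r = u/m`. [cite: BenfattoGiulianiMastropietro2003, §1.2 (2.8b) p.4 (L107–111)] -/
theorem fderiv_jelliumDispersion_levelPoint (hm : m ≠ 0) (μ θ e : ℝ) :
    fderiv ℝ (jelliumDispersion m) (levelPoint (jelliumRadius m μ) θ e) (dir θ) = jelliumRadius m μ θ e / m := by
  rw [fderiv_jelliumDispersion hm]
  simp only [levelPoint, Pi.smul_apply, smul_eq_mul, dir_zero, dir_one]
  have := Real.cos_sq_add_sin_sq θ
  field_simp
  linear_combination jelliumRadius m μ θ e * this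

/-- **The jellium datum belongs to the class of §1.2**: for `m > 0`, `0 < e₀ < μ`, the dispersion
`ε(k⃗) = |k⃗|²/2m` with polar radius `u(θ,e) = √(2m(μ+e))` of `Σ(e)` satisfies `DispersionHyp` — smooth,
`2π`-periodic (constant) in `θ`, `u ≥ √(2m(μ−e₀)) > 0`, `ε(u e⃗_r) = μ + e`, curvature `1/u ≥ 1/√(2m(μ+e₀))`,
radial slope `u/m ∈ [√(2m(μ−e₀))/m, √(2m(μ+e₀))/m]`, even, antipodal (§6: «the Jellium model … implying
rotation invariance»; §1.2 lists it as the continuum example). [cite: BenfattoGiulianiMastropietro2003, §1.2 (2.8a)–(2.8c) p.4 (L97–119) and §6 p.25 (L8–12)] -/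
theorem jellium_dispersionHyp (hm : 0 < m) (he : 0 < e₀) (heμ : e₀ < μ) :
    DispersionHyp (jelliumDispersion m) μ e₀ (jelliumRadius m μ) := by
  have hμ : 0 < μ := he.trans heμ
  have hlo : 0 < μ - e₀ := by linarith
  -- for `|e| ≤ e₀`: `0 < μ + e`
  have hpe : ∀ e : ℝ, |e| ≤ e₀ → 0 < μ + e := fun e he' => by linarith [(abs_le.1 he').1]
  have hm0 : m ≠ 0 := hm.ne'
  refine
    { e₀_pos := he
      smooth_ε := contDiff_jelliumDispersion m
      smooth_u := ?_
      periodic_u := fun e θ => rfl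
      u_pos := ?_
      level := fun θ e he' => jelliumDispersion_levelPoint hm (hpe e he').le θ
      convex := ?_
      radial := ?_
      symm := fun p => by simp [jelliumDispersion]
      antipodal := fun θ e _ => rfl }
  · -- smoothness of `u` on `𝕋¹ × (-e₁, e₁)`, `e₁ = (e₀ + μ)/2`
    refine ⟨(e₀ + μ) / 2, by linarith, ?_⟩
    have hf : ContDiff ℝ ∞ fun p : ℝ × ℝ => 2 * m * (μ + p.2) :=
      contDiff_const.mul (contDiff_const.add contDiff_snd)
    have hfun : uncurry (jelliumRadius m μ) = fun p : ℝ × ℝ => Real.sqrt (2 * m * (μ + p.2)) := by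
      funext p; rfl
    rw [hfun]
    refine hf.contDiffOn.sqrt fun p hp => ?_
    have h2 : -((e₀ + μ) / 2) < p.2 := hp.2.1
    have : 0 < μ + p.2 := by linarith
    positivity
  · -- `u ≥ √(2m(μ - e₀)) > 0`
    refine ⟨Real.sqrt (2 * m * (μ - e₀)), Real.sqrt_pos.2 (by positivity), fun θ e he' => ?_⟩
    exact Real.sqrt_le_sqrt (by nlinarith [(abs_le.1 he').1])
  · -- curvature `1/u ≥ 1/√(2m(μ+e₀))`
    refine ⟨(Real.sqrt (2 * m * (μ + e₀)))⁻¹, inv_pos.2 (Real.sqrt_pos.2 (by positivity)), fun θ e he' => ?_⟩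
    rw [curvature_jelliumRadius hm (hpe e he') θ]
    refine (inv_le_inv₀ (Real.sqrt_pos.2 (by positivity)) (jelliumRadius_pos hm (hpe e he') θ)).2 ?_
    exact Real.sqrt_le_sqrt (by nlinarith [(abs_le.1 he').2])
  · -- radial slope `u/m`
    refine ⟨Real.sqrt (2 * m * (μ - e₀)) / m, Real.sqrt (2 * m * (μ + e₀)) / m,
      div_pos (Real.sqrt_pos.2 (by positivity)) hm,
      div_le_div_of_nonneg_right (Real.sqrt_le_sqrt (by nlinarith)) hm.le, fun θ e he' => ?_⟩
    rw [fderiv_jelliumDispersion_levelPoint hm0]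
    obtain ⟨h1, h2⟩ := abs_le.1 he'
    exact ⟨div_le_div_of_nonneg_right (Real.sqrt_le_sqrt (by nlinarith)) hm.le,
      div_le_div_of_nonneg_right (Real.sqrt_le_sqrt (by nlinarith)) hm.le⟩

/-- **The jellium frame coordinates are the `e⃗_r`, `e⃗_t` components**: `k'₁ = (k⃗ − p_F e⃗_r(θ₀))·e⃗_r(θ₀)`
(the `v₁ ≐ v⃗·n⃗(θ_{h,ω})` of p.25 L45–47). [cite: BenfattoGiulianiMastropietro2003, §6 p.25 (L45–49)] -/
theorem frameCoord₁_jellium (hm : 0 < m) (hμ : 0 < μ) (θ₀ : ℝ) (k : Fin 2 → ℝ) :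
    frameCoord₁ (jelliumRadius m μ) θ₀ k = (k - jelliumFermiMomentum m μ • dir θ₀) ⬝ᵥ dir θ₀ := by
  have h0 : 0 < μ + 0 := by rw [add_zero]; exact hμ
  rw [frameCoord₁, unitNormal_jelliumRadius hm h0, fermiPoint_jelliumRadius]
  simp [dotProduct, Fin.sum_univ_two]

/-- `k'₂ = (k⃗ − p_F e⃗_r(θ₀))·e⃗_t(θ₀)` (the `v₂ ≐ v⃗·τ⃗(θ_{h,ω})` of p.25 L45–47). [cite: BenfattoGiulianiMastropietro2003, §6 p.25 (L45–49)] -/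
theorem frameCoord₂_jellium (hm : 0 < m) (hμ : 0 < μ) (θ₀ : ℝ) (k : Fin 2 → ℝ) :
    frameCoord₂ (jelliumRadius m μ) θ₀ k = (k - jelliumFermiMomentum m μ • dir θ₀) ⬝ᵥ tdir θ₀ := by
  have h0 : 0 < μ + 0 := by rw [add_zero]; exact hμ
  rw [frameCoord₂, unitTangent_jelliumRadius hm h0, fermiPoint_jelliumRadius]
  simp [dotProduct, Fin.sum_univ_two]

end Jellium

/-! ### §M. The Fourier multipliers of `D₁(t)`, `D₂(t)` (7.5) in the anisotropic chart -/

section Multipliers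

/-- `e⃗_r`-component of `r e⃗_r(θ) − p e⃗_r(θ₀)`: `r cos(θ−θ₀) − p`. [cite: BenfattoGiulianiMastropietro2003, §6 p.25 (L45–49)] -/
theorem sub_smul_dir_dotProduct_dir (r p θ θ₀ : ℝ) :
    (r • dir θ - p • dir θ₀) ⬝ᵥ dir θ₀ = r * Real.cos (θ - θ₀) - p := by
  have h := Real.cos_sq_add_sin_sq θ₀
  simp only [dotProduct, Fin.sum_univ_two, Pi.sub_apply, Pi.smul_apply, smul_eq_mul, dir_zero, dir_one,
    Real.cos_sub]
  linear_combination (-p) * h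

/-- `e⃗_t`-component of `r e⃗_r(θ) − p e⃗_r(θ₀)`: `r sin(θ−θ₀)`. [cite: BenfattoGiulianiMastropietro2003, §6 p.25 (L45–49)] -/
theorem sub_smul_dir_dotProduct_tdir (r p θ θ₀ : ℝ) :
    (r • dir θ - p • dir θ₀) ⬝ᵥ tdir θ₀ = r * Real.sin (θ - θ₀) := by
  simp only [dotProduct, Fin.sum_univ_two, Pi.sub_apply, Pi.smul_apply, smul_eq_mul, dir_zero, dir_one,
    tdir_apply_zero', tdir_apply_one', Real.sin_sub]
  ring

/-- `cos(3π/4) ≥ −3/4`-type bound: `|y| ≤ 3π/4 ⟹ −3/4 ≤ cos y` (`cos(3π/4) = −√2/2 ≥ −3/4`). [folklore] -/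
private theorem neg_three_div_four_le_cos {y : ℝ} (hy : |y| ≤ 3 * π / 4) : -(3 / 4 : ℝ) ≤ Real.cos y := by
  have hπ := Real.pi_pos
  have h1 : Real.cos (3 * π / 4) ≤ Real.cos |y| :=
    Real.cos_le_cos_of_nonneg_of_le_pi (abs_nonneg y) (by linarith) hy
  rw [Real.cos_abs] at h1
  have h2 : Real.cos (3 * π / 4) = -(Real.sqrt 2 / 2) := by
    rw [show 3 * π / 4 = π / 4 + π / 2 by ring, Real.cos_add_pi_div_two, Real.sin_pi_div_four]
  have h3 : Real.sqrt 2 ≤ 3 / 2 := by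
    nlinarith [Real.sq_sqrt (show (0 : ℝ) ≤ 2 by norm_num), Real.sqrt_nonneg 2]
  linarith

/-- On the support of `ζ_{h,ω}` the angle to the sector centre has `cos ≥ −3/4`
(`|θ − θ_{h,ω}| < 3w_h/4 ≤ 3π/4` modulo `2π`). [cite: BenfattoGiulianiMastropietro2003, §2.2 (3.14a) p.7 (L131–137)] -/
theorem neg_three_div_four_le_cos_of_sectorWeightCirc_ne_zero {n σ : ℕ} {θ : ℝ}
    (hζ : sectorWeightCirc n σ θ ≠ 0) : -(3 / 4 : ℝ) ≤ Real.cos (θ - sectorCenter n σ) := by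
  have hw := sectorWidth_le_pi n
  have hw0 := sectorWidth_pos n
  -- some translate is within `3w/4`
  have hex : ∃ k : ℤ, |θ - ((σ : ℝ) + 1 / 2) * sectorWidth n - 2 * π * k| < 3 * sectorWidth n / 4 := by
    by_contra hne
    push Not at hne
    have hzero := @sectorWeightCirc_eq_zero n (σ : ℤ) θ (fun k => by
      have h := hne k
      push_cast
      exact h)
    exact hζ hzero
  obtain ⟨k, hk⟩ := hex
  have hper : Real.cos (θ - sectorCenter n σ) = Real.cos (θ - ((σ : ℝ) + 1 / 2) * sectorWidth n - 2 * π * k) := by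
    rw [sectorCenter, show θ - ((σ : ℝ) + 1 / 2) * sectorWidth n - 2 * π * k =
      θ - ((σ : ℝ) + 1 / 2) * sectorWidth n - k * (2 * π) by ring, Real.cos_periodic.sub_int_mul_eq]
  rw [hper]
  exact neg_three_div_four_le_cos (by linarith [hk.le])

variable {m μ e₀ : ℝ}

/-- **`ρ(t)` stays away from zero on a sector**: for `k⃗ ∈ S_{h,ω}` of the jellium shell and `t ∈ [0,1]`,
`ρ(t)² = (tk'₁ + p_F)² + (tk'₂)² = |t k⃗ + (1−t)p⃗_F(θ_{h,ω})|² ≥ m(μ−e₀)/4` — the interpolation (7.2) between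
`p⃗_F(θ_{h,ω})` and `k⃗` never passes near the origin because the sector's angular aperture is `< 3π/4`.
[cite: BenfattoGiulianiMastropietro2003, §6 (7.2) p.25 (L36–49)] -/
theorem dRho_lower_of_mem_sSector (hm : 0 < m) (he : 0 < e₀) (heμ : e₀ < μ) {n σ : ℕ}
    {k : Fin 2 → ℝ} (hk : k ∈ sSector (jelliumRadius m μ) e₀ n σ) {t : ℝ} (ht : t ∈ Icc (0 : ℝ) 1) :
    m * (μ - e₀) / 4 ≤
      (t * ((k - jelliumFermiMomentum m μ • dir (sectorCenter n σ)) ⬝ᵥ dir (sectorCenter n σ)) +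
          jelliumFermiMomentum m μ) ^ 2 +
        (t * ((k - jelliumFermiMomentum m μ • dir (sectorCenter n σ)) ⬝ᵥ tdir (sectorCenter n σ))) ^ 2 := by
  obtain ⟨θ, e, heB, hζ, rfl⟩ := hk
  have hμ : 0 < μ := he.trans heμ
  have h4le : (4 : ℝ) ^ (-(n : ℤ)) ≤ 1 := zpow_le_one_of_nonpos₀ (by norm_num) (by simp)
  have he' : |e| ≤ e₀ := heB.trans (by nlinarith)
  have hpe : 0 < μ + e := by linarith [(abs_le.1 he').1]
  set θ₀ := sectorCenter n σ with hθ₀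
  set r : ℝ := jelliumRadius m μ θ e with hr
  set pF : ℝ := jelliumFermiMomentum m μ with hpF
  set rm : ℝ := Real.sqrt (2 * m * (μ - e₀)) with hrm
  have hr0 : 0 ≤ r := jelliumRadius_nonneg m μ θ e
  have hpF0 : 0 ≤ pF := Real.sqrt_nonneg _
  have hrm0 : 0 ≤ rm := Real.sqrt_nonneg _
  have hrm2 : rm ^ 2 = 2 * m * (μ - e₀) := Real.sq_sqrt (by nlinarith)
  have hrm_r : rm ≤ r := Real.sqrt_le_sqrt (by nlinarith [(abs_le.1 he').1])
  have hrm_p : rm ≤ pF := Real.sqrt_le_sqrt (by nlinarith)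
  rw [levelPoint, ← hr, sub_smul_dir_dotProduct_dir, sub_smul_dir_dotProduct_tdir]
  set c := Real.cos (θ - θ₀) with hc
  set sn := Real.sin (θ - θ₀) with hsn
  have hcs : c ^ 2 + sn ^ 2 = 1 := Real.cos_sq_add_sin_sq _
  have hc34 : -(3 / 4 : ℝ) ≤ c := neg_three_div_four_le_cos_of_sectorWeightCirc_ne_zero hζ
  have key : (t * (r * c - pF) + pF) ^ 2 + (t * (r * sn)) ^ 2 =
      1 / 8 * (t * r + (1 - t) * pF) ^ 2 + 7 / 8 * (t * r - (1 - t) * pF) ^ 2 +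
        2 * (t * r) * ((1 - t) * pF) * (c + 3 / 4) := by
    linear_combination (t * r) ^ 2 * hcs
  rw [key]
  have hA : 0 ≤ t * r := mul_nonneg ht.1 hr0
  have hB : 0 ≤ (1 - t) * pF := mul_nonneg (by linarith [ht.2]) hpF0
  have hsum : rm ≤ t * r + (1 - t) * pF := by nlinarith [ht.1, ht.2]
  have hsq : rm ^ 2 ≤ (t * r + (1 - t) * pF) ^ 2 := pow_le_pow_left₀ hrm0 hsum 2
  nlinarith [mul_nonneg (mul_nonneg hA hB) (by linarith : (0 : ℝ) ≤ c + 3 / 4),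
    sq_nonneg (t * r - (1 - t) * pF)]

/-- `ρ(t)²` in chart coordinates (`k'₁ = s²a`, `k'₂ = sb`, `s = γ^{h/2}`): `(t s²a + p_F)² + (t s b)²`.
[cite: BenfattoGiulianiMastropietro2003, §6 (7.2) p.25 (L45–49) and §2.3 (3.21a) p.8 (L36–41)] -/
def dRhoSq (pF a b t s : ℝ) : ℝ := (t * (s ^ 2 * a) + pF) ^ 2 + (t * (s * b)) ^ 2

/-- The common factor `((tk'₁ + p_F)k'₁ + t(k'₂)²)/s² = (t s²a + p_F)a + t b²` of (7.5). [cite: BenfattoGiulianiMastropietro2003, §6 (7.5) p.25 (L80–90)] -/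
def dCore (pF a b t s : ℝ) : ℝ := (t * (s ^ 2 * a) + pF) * a + t * b ^ 2

/-- **The rescaled multiplier of `D₁(t)`**: `M₁ = (t s²a + p_F)·((t s²a + p_F)a + t b²)·η(ρ²)`, `η` the tree's
`sectorInvCutoff q₀` (`= 1/ρ²` where `ρ² ≥ q₀/2`, smooth through `ρ = 0`); on the sector support
`m₁(t, k⃗) = s² M₁` (`= γ^h M₁`: «each operator `D_i(t)` improves the bound by a factor at least `γ^h`»).
[cite: BenfattoGiulianiMastropietro2003, §6 (7.5) p.25 (L80–90) and Remark p.25 (L129–136)] -/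
def rMult₁ (pF q₀ a b t s : ℝ) : ℝ :=
  (t * (s ^ 2 * a) + pF) * dCore pF a b t s * sectorInvCutoff q₀ (dRhoSq pF a b t s)

/-- **The rescaled multiplier of `D₂(t)`**: `M₂ = t b·((t s²a + p_F)a + t b²)·η(ρ²)`; on the sector support
`m₂(t, k⃗) = s³ M₂` (`= γ^{3h/2} M₂`). [cite: BenfattoGiulianiMastropietro2003, §6 (7.5) p.25 (L80–90) and Remark p.25 (L129–136)] -/
def rMult₂ (pF q₀ a b t s : ℝ) : ℝ :=
  t * b * dCore pF a b t s * sectorInvCutoff q₀ (dRhoSq pF a b t s)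

/-- `M₁` is smooth in `(a, b, t, s) ∈ ℝ⁴` (for `q₀ > 0`). [cite: BenfattoGiulianiMastropietro2003, §6 (7.5) p.25 (L80–90)] -/
theorem contDiff_rMult₁ (pF : ℝ) {q₀ : ℝ} (hq₀ : 0 < q₀) :
    ContDiff ℝ ∞ fun x : ℝ × ℝ × ℝ × ℝ => rMult₁ pF q₀ x.1 x.2.1 x.2.2.1 x.2.2.2 := by
  have ha : ContDiff ℝ ∞ fun x : ℝ × ℝ × ℝ × ℝ => x.1 := contDiff_fst
  have hb : ContDiff ℝ ∞ fun x : ℝ × ℝ × ℝ × ℝ => x.2.1 := contDiff_fst.comp contDiff_snd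
  have ht : ContDiff ℝ ∞ fun x : ℝ × ℝ × ℝ × ℝ => x.2.2.1 := contDiff_fst.comp (contDiff_snd.comp contDiff_snd)
  have hs : ContDiff ℝ ∞ fun x : ℝ × ℝ × ℝ × ℝ => x.2.2.2 := contDiff_snd.comp (contDiff_snd.comp contDiff_snd)
  have hlin := (ht.mul ((hs.pow 2).mul ha)).add (contDiff_const (c := pF))
  have hcore := (hlin.mul ha).add (ht.mul (hb.pow 2))
  have hrho := (hlin.pow 2).add ((ht.mul (hs.mul hb)).pow 2)
  have hη := (contDiff_sectorInvCutoff (n := (⊤ : ℕ∞)) hq₀).comp hrho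
  exact (hlin.mul hcore).mul hη

/-- `M₂` is smooth in `(a, b, t, s) ∈ ℝ⁴` (for `q₀ > 0`). [cite: BenfattoGiulianiMastropietro2003, §6 (7.5) p.25 (L80–90)] -/
theorem contDiff_rMult₂ (pF : ℝ) {q₀ : ℝ} (hq₀ : 0 < q₀) :
    ContDiff ℝ ∞ fun x : ℝ × ℝ × ℝ × ℝ => rMult₂ pF q₀ x.1 x.2.1 x.2.2.1 x.2.2.2 := by
  have ha : ContDiff ℝ ∞ fun x : ℝ × ℝ × ℝ × ℝ => x.1 := contDiff_fst
  have hb : ContDiff ℝ ∞ fun x : ℝ × ℝ × ℝ × ℝ => x.2.1 := contDiff_fst.comp contDiff_snd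
  have ht : ContDiff ℝ ∞ fun x : ℝ × ℝ × ℝ × ℝ => x.2.2.1 := contDiff_fst.comp (contDiff_snd.comp contDiff_snd)
  have hs : ContDiff ℝ ∞ fun x : ℝ × ℝ × ℝ × ℝ => x.2.2.2 := contDiff_snd.comp (contDiff_snd.comp contDiff_snd)
  have hlin := (ht.mul ((hs.pow 2).mul ha)).add (contDiff_const (c := pF))
  have hcore := (hlin.mul ha).add (ht.mul (hb.pow 2))
  have hrho := (hlin.pow 2).add ((ht.mul (hs.mul hb)).pow 2)
  have hη := (contDiff_sectorInvCutoff (n := (⊤ : ℕ∞)) hq₀).comp hrho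
  exact ((ht.mul hb).mul hcore).mul hη

/-- **`m₁(t, k⃗) = s² M₁` in the chart** once `ρ(t)² ≥ q₀/2`: for `k'₁ = s²a`, `k'₂ = sb`,
`(tk'₁+p_F)/ρ · ((tk'₁+p_F)k'₁ + t(k'₂)²)/ρ = s²·(t s²a+p_F)((t s²a+p_F)a + t b²)/ρ²`. [cite: BenfattoGiulianiMastropietro2003, §6 (7.5) p.25 (L80–90)] -/
theorem dMultiplier₁_eq_of_coords {pF q₀ θ₀ t a b s : ℝ} (hq₀ : 0 < q₀) {k : Fin 2 → ℝ}
    (h1 : (k - pF • dir θ₀) ⬝ᵥ dir θ₀ = s ^ 2 * a) (h2 : (k - pF • dir θ₀) ⬝ᵥ tdir θ₀ = s * b)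
    (hρ : q₀ / 2 ≤ dRhoSq pF a b t s) :
    dMultiplier₁ pF θ₀ t k = s ^ 2 * rMult₁ pF q₀ a b t s := by
  have hD0 : 0 < dRhoSq pF a b t s := lt_of_lt_of_le (by positivity) hρ
  have hsq : Real.sqrt (dRhoSq pF a b t s) ≠ 0 := (Real.sqrt_pos.2 hD0).ne'
  rw [dMultiplier₁, h1, h2, rMult₁, sectorInvCutoff_eq_inv hq₀ hρ]
  have hrw : (t * (s ^ 2 * a) + pF) ^ 2 + (t * (s * b)) ^ 2 = dRhoSq pF a b t s := rfl
  rw [hrw, dCore]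
  field_simp
  rw [Real.sq_sqrt hD0.le]
  ring

/-- **`m₂(t, k⃗) = s³ M₂` in the chart** once `ρ(t)² ≥ q₀/2`. [cite: BenfattoGiulianiMastropietro2003, §6 (7.5) p.25 (L80–90)] -/
theorem dMultiplier₂_eq_of_coords {pF q₀ θ₀ t a b s : ℝ} (hq₀ : 0 < q₀) {k : Fin 2 → ℝ}
    (h1 : (k - pF • dir θ₀) ⬝ᵥ dir θ₀ = s ^ 2 * a) (h2 : (k - pF • dir θ₀) ⬝ᵥ tdir θ₀ = s * b)
    (hρ : q₀ / 2 ≤ dRhoSq pF a b t s) :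
    dMultiplier₂ pF θ₀ t k = s ^ 3 * rMult₂ pF q₀ a b t s := by
  have hD0 : 0 < dRhoSq pF a b t s := lt_of_lt_of_le (by positivity) hρ
  have hsq : Real.sqrt (dRhoSq pF a b t s) ≠ 0 := (Real.sqrt_pos.2 hD0).ne'
  rw [dMultiplier₂, h1, h2, rMult₂, sectorInvCutoff_eq_inv hq₀ hρ]
  have hrw : (t * (s ^ 2 * a) + pF) ^ 2 + (t * (s * b)) ^ 2 = dRhoSq pF a b t s := rfl
  rw [hrw, dCore]
  field_simp
  rw [Real.sq_sqrt hD0.le]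
  ring

end Multipliers

/-! ### §S. The `D`-weighted sector symbol, its rescaling, and the master function -/

section Symbol

variable {m μ e₀ : ℝ}

/-- The threshold `q₀ = m(μ−e₀)/2` of the regularised `1/ρ²` (`ρ² ≥ q₀/2` on every sector, `dRho_lower_of_mem_sSector`).
[cite: BenfattoGiulianiMastropietro2003, §6 (7.2) p.25 (L45–49)] -/
def dQ₀ (m μ e₀ : ℝ) : ℝ := m * (μ - e₀) / 2

/-- `q₀ > 0`. [cite: BenfattoGiulianiMastropietro2003, §6 (7.2) p.25 (L45–49)] -/
theorem dQ₀_pos (hm : 0 < m) (heμ : e₀ < μ) : 0 < dQ₀ m μ e₀ := by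
  unfold dQ₀; nlinarith

/-- **The `D`-weighted sector symbol** of the jellium model, scale `h = −n`, sector `σ`:
`S^D(k) = (−ik₀)^{n₀} · Π_j (i m₁(t_j, k⃗)) · Π_j (i m₂(s_j, k⃗)) · F_{h,σ}(k)/(−ik₀ + ε(k⃗) − μ)` — the integrand of
F3c's `jelliumPropagatorD` stripped of `(2π)^{-3} e^{-i(k₀x₀ + k⃗'x⃗)}`, times the weight `(−ik₀)^{n₀}` that `∂₀^{n₀}`
brings down. [cite: BenfattoGiulianiMastropietro2003, §6 (7.5), (7.11) p.25 (L80–90, L116–127)] -/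
def wSymbolD (m μ e₀ : ℝ) (n σ n₀ : ℕ) {n₁ n₂ : ℕ} (tv : Fin n₁ → ℝ) (sv : Fin n₂ → ℝ)
    (p : ℝ × (Fin 2 → ℝ)) : ℂ :=
  (-(I * (p.1 : ℂ))) ^ n₀ *
    ((∏ j : Fin n₁, (I * ((dMultiplier₁ (jelliumFermiMomentum m μ) (sectorCenter n σ) (tv j) p.2 : ℝ) : ℂ))) *
      (∏ j : Fin n₂, (I * ((dMultiplier₂ (jelliumFermiMomentum m μ) (sectorCenter n σ) (sv j) p.2 : ℝ) : ℂ)))) *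
    (((sectorCutoff (jelliumDispersion m) μ e₀ (jelliumRadius m μ) n σ p : ℝ) : ℂ) /
      (-(I * (p.1 : ℂ)) + ((jelliumDispersion m p.2 - μ : ℝ) : ℂ)))

/-- `S^D = S_{(n₀,0,0)} · Π_j (i m₁(t_j)) Π_j (i m₂(s_j))` with part 2's weighted symbol `wSymbol`.
[cite: BenfattoGiulianiMastropietro2003, §6 (7.5), (7.11) p.25 (L80–90, L116–127)] -/
theorem wSymbolD_eq (m μ e₀ : ℝ) (n σ n₀ : ℕ) {n₁ n₂ : ℕ} (tv : Fin n₁ → ℝ) (sv : Fin n₂ → ℝ)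
    (p : ℝ × (Fin 2 → ℝ)) :
    wSymbolD m μ e₀ n σ n₀ tv sv p =
      wSymbol (jelliumDispersion m) μ e₀ (jelliumRadius m μ) n σ n₀ 0 0 p *
        ((∏ j : Fin n₁, (I * ((dMultiplier₁ (jelliumFermiMomentum m μ) (sectorCenter n σ) (tv j) p.2 : ℝ) : ℂ))) *
          (∏ j : Fin n₂, (I * ((dMultiplier₂ (jelliumFermiMomentum m μ) (sectorCenter n σ) (sv j) p.2 : ℝ) : ℂ)))) := by
  simp only [wSymbolD, wSymbol, pow_zero, mul_one]
  ring

/-- **The `D`-weighted symbol in chart coordinates** `t = (t₀, a, b)`: `k₀ = 4^{-n}t₀`,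
`k⃗ = p_F e⃗_r(θ_{h,σ}) + 4^{-n}a e⃗_r + 2^{-n}b e⃗_t` (`= chartPt (θ_{h,σ},a,b) 2^{-n}` in the jellium frame).
[cite: BenfattoGiulianiMastropietro2003, §2.3 (3.21a) p.8 (L36–41) and §7.2 p.27 (L28–52)] -/
def rescaledWSymbolD (m μ e₀ : ℝ) (n σ n₀ : ℕ) {n₁ n₂ : ℕ} (tv : Fin n₁ → ℝ) (sv : Fin n₂ → ℝ) :
    MomSpace → ℂ :=
  fun t => wSymbolD m μ e₀ n σ n₀ tv sv
    ((4 : ℝ) ^ (-(n : ℤ)) * t 0, chartPt (jelliumRadius m μ) (sectorCenter n σ, t 1, t 2) ((2 : ℝ) ^ (-(n : ℤ))))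

/-- `R^D = R_{(n₀,0,0)} · Π (multipliers at the chart point)`. [cite: BenfattoGiulianiMastropietro2003, §7.2 p.27 (L28–52)] -/
theorem rescaledWSymbolD_apply (m μ e₀ : ℝ) (n σ n₀ : ℕ) {n₁ n₂ : ℕ} (tv : Fin n₁ → ℝ) (sv : Fin n₂ → ℝ)
    (t : MomSpace) :
    rescaledWSymbolD m μ e₀ n σ n₀ tv sv t =
      rescaledWSymbol (jelliumDispersion m) μ e₀ (jelliumRadius m μ) n σ n₀ 0 0 t *
        ((∏ j : Fin n₁, (I * ((dMultiplier₁ (jelliumFermiMomentum m μ) (sectorCenter n σ) (tv j)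
            (chartPt (jelliumRadius m μ) (sectorCenter n σ, t 1, t 2) ((2 : ℝ) ^ (-(n : ℤ)))) : ℝ) : ℂ))) *
          (∏ j : Fin n₂, (I * ((dMultiplier₂ (jelliumFermiMomentum m μ) (sectorCenter n σ) (sv j)
            (chartPt (jelliumRadius m μ) (sectorCenter n σ, t 1, t 2) ((2 : ℝ) ^ (-(n : ℤ)))) : ℝ) : ℂ)))) := by
  rw [rescaledWSymbolD, rescaledWSymbol, wSymbolD_eq]

/-- **The scale factor of the `D`-weighted symbol**: `γ^{-h}γ^{hn₀} · (γ^h)^{n₁} · (γ^{3h/2})^{n₂}`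
`= scaleFactor n n₀ 0 0 · (s²)^{n₁} (s³)^{n₂}`, `s = 2^{-n} = γ^{h/2}` — the dimensional gains `γ^h` per `D₁` and
`γ^{3h/2}` per `D₂` of (7.11). [cite: BenfattoGiulianiMastropietro2003, §6 Lemma 6.1 (7.11) p.25 (L116–136)] -/
def scaleFactorD (n n₀ n₁ n₂ : ℕ) : ℝ :=
  scaleFactor n n₀ 0 0 * ((((2 : ℝ) ^ (-(n : ℤ))) ^ 2) ^ n₁ * (((2 : ℝ) ^ (-(n : ℤ))) ^ 3) ^ n₂)

/-- `0 < scaleFactorD`. [cite: BenfattoGiulianiMastropietro2003, §6 Lemma 6.1 (7.11) p.25 (L116–127)] -/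
theorem scaleFactorD_pos (n n₀ n₁ n₂ : ℕ) : 0 < scaleFactorD n n₀ n₁ n₂ := by
  unfold scaleFactorD
  have := scaleFactor_pos n n₀ 0 0
  positivity

/-- **The `D`-master function** on `(((θ₀, s), (t⃗, s⃗)), t) ∈ (ℝ² × (ℝ^{n₁} × ℝ^{n₂})) × ℝ³`: part 2's master
function at `α = (n₀,0,0)` times `Π_j (i M₁(a,b,t_j,s)) · Π_j (i M₂(a,b,s_j,s))` (the truncation radius `r` and the
shell bump `χ` as parameters). [cite: BenfattoGiulianiMastropietro2003, §6 (7.5), (7.11) p.25 (L80–127) and §7.2 p.27 (L28–52)] -/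
def masterDL (m μ e₀ r : ℝ) (χ : (Fin 2 → ℝ) → ℝ) (n₀ n₁ n₂ : ℕ)
    (q : ((ℝ × ℝ) × ((Fin n₁ → ℝ) × (Fin n₂ → ℝ))) × MomSpace) : ℂ :=
  masterL (jelliumDispersion m) (jelliumRadius m μ) μ e₀ r χ n₀ 0 0 (q.1.1, q.2) *
    ((∏ j : Fin n₁,
        (I * ((rMult₁ (jelliumFermiMomentum m μ) (dQ₀ m μ e₀) (q.2 1) (q.2 2) (q.1.2.1 j) q.1.1.2 : ℝ) : ℂ))) *
      (∏ j : Fin n₂,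
        (I * ((rMult₂ (jelliumFermiMomentum m μ) (dQ₀ m μ e₀) (q.2 1) (q.2 2) (q.1.2.2 j) q.1.1.2 : ℝ) : ℂ))))

/-- Coordinates of `ℝ³` are smooth on the parameter product. [folklore] -/
private theorem contDiff_coordP {P : Type*} [NormedAddCommGroup P] [NormedSpace ℝ P] (i : Fin 3) :
    ContDiff ℝ ∞ fun q : P × MomSpace => q.2 i :=
  (contDiff_piLp_apply (𝕜 := ℝ) (p := 2) (n := ∞) (i := i)).comp contDiff_snd

/-- **The `D`-master function is jointly smooth** (for `m > 0`, `0 < e₀ < μ`, `r > 0`, smooth `χ`).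
[cite: BenfattoGiulianiMastropietro2003, §7.2 p.27 (L28–52)] -/
theorem contDiff_masterDL (hm : 0 < m) (he : 0 < e₀) (heμ : e₀ < μ) {r : ℝ} (hr : 0 < r)
    {χ : (Fin 2 → ℝ) → ℝ} (hχ : ContDiff ℝ ∞ χ) (n₀ n₁ n₂ : ℕ) :
    ContDiff ℝ ∞ (masterDL m μ e₀ r χ n₀ n₁ n₂) := by
  have hD := jellium_dispersionHyp hm he heμ
  have hq₀ := dQ₀_pos hm heμ
  set P : Type := (ℝ × ℝ) × ((Fin n₁ → ℝ) × (Fin n₂ → ℝ))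
  -- the master factor through the projection `q ↦ ((θ₀, s), t)`
  have hproj : ContDiff ℝ ∞ fun q : P × MomSpace => ((q.1.1, q.2) : (ℝ × ℝ) × MomSpace) :=
    (contDiff_fst.comp contDiff_fst).prodMk contDiff_snd
  have hML : ContDiff ℝ ∞ fun q : P × MomSpace =>
      masterL (jelliumDispersion m) (jelliumRadius m μ) μ e₀ r χ n₀ 0 0 (q.1.1, q.2) :=
    (hD.contDiff_masterL hr hχ n₀ 0 0).comp hproj
  -- the coordinates feeding the multipliers
  have ha : ContDiff ℝ ∞ fun q : P × MomSpace => q.2 1 := contDiff_coordP 1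
  have hb : ContDiff ℝ ∞ fun q : P × MomSpace => q.2 2 := contDiff_coordP 2
  have hs : ContDiff ℝ ∞ fun q : P × MomSpace => q.1.1.2 := contDiff_snd.comp (contDiff_fst.comp contDiff_fst)
  have htv : ∀ j : Fin n₁, ContDiff ℝ ∞ fun q : P × MomSpace => q.1.2.1 j := fun j =>
    (contDiff_apply ℝ ℝ j).comp (contDiff_fst.comp (contDiff_snd.comp contDiff_fst))
  have hsv : ∀ j : Fin n₂, ContDiff ℝ ∞ fun q : P × MomSpace => q.1.2.2 j := fun j =>
    (contDiff_apply ℝ ℝ j).comp (contDiff_snd.comp (contDiff_snd.comp contDiff_fst))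
  have hM1 := contDiff_rMult₁ (jelliumFermiMomentum m μ) hq₀
  have hM2 := contDiff_rMult₂ (jelliumFermiMomentum m μ) hq₀
  have hP1 : ContDiff ℝ ∞ fun q : P × MomSpace => ∏ j : Fin n₁,
      (I * ((rMult₁ (jelliumFermiMomentum m μ) (dQ₀ m μ e₀) (q.2 1) (q.2 2) (q.1.2.1 j) q.1.1.2 : ℝ) : ℂ)) := by
    refine contDiff_prod fun j _ => contDiff_const.mul (Complex.ofRealCLM.contDiff.comp ?_)
    exact hM1.comp (ha.prodMk (hb.prodMk ((htv j).prodMk hs)))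
  have hP2 : ContDiff ℝ ∞ fun q : P × MomSpace => ∏ j : Fin n₂,
      (I * ((rMult₂ (jelliumFermiMomentum m μ) (dQ₀ m μ e₀) (q.2 1) (q.2 2) (q.1.2.2 j) q.1.1.2 : ℝ) : ℂ)) := by
    refine contDiff_prod fun j _ => contDiff_const.mul (Complex.ofRealCLM.contDiff.comp ?_)
    exact hM2.comp (ha.prodMk (hb.prodMk ((hsv j).prodMk hs)))
  exact hML.mul (hP1.mul hP2)

/-- `(2^{-n})² = 4^{-n}`. [cite: BenfattoGiulianiMastropietro2003, §2.3 p.7 (L131–133)] -/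
private theorem two_zpow_neg_sq'' (n : ℕ) : ((2 : ℝ) ^ (-(n : ℤ))) ^ 2 = (4 : ℝ) ^ (-(n : ℤ)) := by
  rw [← zpow_natCast, ← zpow_mul, show (4 : ℝ) = 2 ^ (2 : ℤ) by norm_num, ← zpow_mul]; congr 1; ring

/-- A product of rescaled factors: `Π_j (i · (c M_j)) = c^{n} Π_j (i M_j)`. [folklore] -/
private theorem prod_I_mul_ofReal_mul {k : ℕ} (c : ℝ) (M : Fin k → ℝ) :
    (∏ j : Fin k, (I * ((c * M j : ℝ) : ℂ))) = ((c ^ k : ℝ) : ℂ) * ∏ j : Fin k, (I * ((M j : ℝ) : ℂ)) := by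
  have h : ∀ j : Fin k, I * ((c * M j : ℝ) : ℂ) = (c : ℂ) * (I * ((M j : ℝ) : ℂ)) := fun j => by
    push_cast; ring
  rw [Finset.prod_congr rfl fun j _ => h j, Finset.prod_mul_distrib, Finset.prod_const, Finset.card_univ,
    Fintype.card_fin]
  push_cast
  ring

/-- **The central identity for the `D`-weighted symbol.**  Let `χ` be a shell bump as in part 1.  Then for
every `h = −n ≤ 0`, sector `σ`, interpolation parameters `t_j, s_j ∈ [0,1]` and `t = (t₀,a,b)`:
`R^D(t) = scaleFactorD · Ψ^D((θ_{h,σ}, 2^{-n}), (t⃗, s⃗); t)` — part 2's identity for the factor `S_{(n₀,0,0)}`, and on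
its support (a sector, where `ρ(t_j)² ≥ m(μ−e₀)/4`) `m₁(t_j) = s²M₁`, `m₂(s_j) = s³M₂`.
[cite: BenfattoGiulianiMastropietro2003, §6 (7.5), (7.11) p.25 (L80–136) and §7.2 p.27 (L28–52)] -/
theorem rescaledWSymbolD_eq_smul_masterDL (hm : 0 < m) (he : 0 < e₀) (heμ : e₀ < μ) {r : ℝ} (hr : 0 < r)
    {χ : (Fin 2 → ℝ) → ℝ} (hχ1 : ∀ k ∈ shell (jelliumRadius m μ) e₀, χ k = 1)
    (hχr : ∀ k, χ k ≠ 0 → 2 * r ≤ ‖momToComplex k‖)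
    (hχε : ∀ k, χ k ≠ 0 → k ∉ shell (jelliumRadius m μ) e₀ → e₀ < |jelliumDispersion m k - μ|)
    (n σ n₀ : ℕ) {n₁ n₂ : ℕ} {tv : Fin n₁ → ℝ} {sv : Fin n₂ → ℝ} (htv : ∀ j, tv j ∈ Icc (0 : ℝ) 1)
    (hsv : ∀ j, sv j ∈ Icc (0 : ℝ) 1) :
    rescaledWSymbolD m μ e₀ n σ n₀ tv sv = fun t =>
      ((scaleFactorD n n₀ n₁ n₂ : ℝ) : ℂ) •
        masterDL m μ e₀ r χ n₀ n₁ n₂ (((sectorCenter n σ, (2 : ℝ) ^ (-(n : ℤ))), (tv, sv)), t) := by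
  have hD := jellium_dispersionHyp hm he heμ
  have hμ : 0 < μ := he.trans heμ
  have hq₀ := dQ₀_pos hm heμ
  funext t
  have hbase := hD.rescaledWSymbol_eq_master hr hχ1 hχr hχε n σ n₀ 0 0 t
  rw [rescaledWSymbolD_apply, hbase, smul_eq_mul, masterDL, scaleFactorD]
  dsimp only
  set θ₀ : ℝ := sectorCenter n σ with hθ₀
  set s : ℝ := (2 : ℝ) ^ (-(n : ℤ)) with hs
  set pF : ℝ := jelliumFermiMomentum m μ with hpF
  set q₀ : ℝ := dQ₀ m μ e₀ with hq₀def
  set k : Fin 2 → ℝ := chartPt (jelliumRadius m μ) (θ₀, t 1, t 2) s with hk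
  have hML : masterL (jelliumDispersion m) (jelliumRadius m μ) μ e₀ r χ n₀ 0 0 ((θ₀, s), t) =
      master (jelliumDispersion m) (jelliumRadius m μ) μ e₀ r χ n₀ 0 0 (θ₀, t 1, t 2) (t 0) s := rfl
  rw [hML]
  have hSF : ((scaleFactor n n₀ 0 0 : ℝ) : ℂ) ≠ 0 := by exact_mod_cast (scaleFactor_pos n n₀ 0 0).ne'
  by_cases h0 : master (jelliumDispersion m) (jelliumRadius m μ) μ e₀ r χ n₀ 0 0 (θ₀, t 1, t 2) (t 0) s = 0
  · -- off the support both sides vanish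
    rw [h0]; simp
  · -- on the support: `k ∈ S_{h,σ}`, so `ρ(τ)² ≥ q₀/2` for `τ ∈ [0,1]`
    have h0' : wSymbol (jelliumDispersion m) μ e₀ (jelliumRadius m μ) n σ n₀ 0 0 ((4 : ℝ) ^ (-(n : ℤ)) * t 0, k) ≠ 0 := by
      change rescaledWSymbol (jelliumDispersion m) μ e₀ (jelliumRadius m μ) n σ n₀ 0 0 t ≠ 0
      rw [hbase]
      exact mul_ne_zero hSF h0
    obtain ⟨hsec, -⟩ := hD.mem_sSector_of_wSymbol_ne_zero h0'
    have hc1 : (k - pF • dir θ₀) ⬝ᵥ dir θ₀ = s ^ 2 * t 1 := by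
      rw [hpF, ← frameCoord₁_jellium hm hμ, hk, hD.frameCoord₁_chartPt]
    have hc2 : (k - pF • dir θ₀) ⬝ᵥ tdir θ₀ = s * t 2 := by
      rw [hpF, ← frameCoord₂_jellium hm hμ, hk, hD.frameCoord₂_chartPt]
    have hρ : ∀ τ ∈ Icc (0 : ℝ) 1, q₀ / 2 ≤ dRhoSq pF (t 1) (t 2) τ s := by
      intro τ hτ
      have h := dRho_lower_of_mem_sSector hm he heμ hsec hτ
      rw [← hθ₀, ← hpF, hc1, hc2] at h
      have hq : q₀ / 2 = m * (μ - e₀) / 4 := by rw [hq₀def, dQ₀]; ring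
      rw [hq, dRhoSq]
      exact h
    have hD1 : ∀ j : Fin n₁, dMultiplier₁ pF θ₀ (tv j) k = s ^ 2 * rMult₁ pF q₀ (t 1) (t 2) (tv j) s := fun j =>
      dMultiplier₁_eq_of_coords hq₀ hc1 hc2 (hρ _ (htv j))
    have hD2 : ∀ j : Fin n₂, dMultiplier₂ pF θ₀ (sv j) k = s ^ 3 * rMult₂ pF q₀ (t 1) (t 2) (sv j) s := fun j =>
      dMultiplier₂_eq_of_coords hq₀ hc1 hc2 (hρ _ (hsv j))
    have hP1 : (∏ j : Fin n₁, (I * ((dMultiplier₁ pF θ₀ (tv j) k : ℝ) : ℂ))) =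
        (((s ^ 2) ^ n₁ : ℝ) : ℂ) * ∏ j : Fin n₁, (I * ((rMult₁ pF q₀ (t 1) (t 2) (tv j) s : ℝ) : ℂ)) := by
      rw [← prod_I_mul_ofReal_mul]
      exact Finset.prod_congr rfl fun j _ => by rw [hD1 j]
    have hP2 : (∏ j : Fin n₂, (I * ((dMultiplier₂ pF θ₀ (sv j) k : ℝ) : ℂ))) =
        (((s ^ 3) ^ n₂ : ℝ) : ℂ) * ∏ j : Fin n₂, (I * ((rMult₂ pF q₀ (t 1) (t 2) (sv j) s : ℝ) : ℂ)) := by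
      rw [← prod_I_mul_ofReal_mul]
      exact Finset.prod_congr rfl fun j _ => by rw [hD2 j]
    rw [hP1, hP2]
    push_cast
    ring

/-- **The support box of the `D`-weighted symbol** is inside part 2's box (the extra factors only multiply):
`R^D(t) ≠ 0 ⟹ |t₀| ≤ e₀, |a| ≤ c, |b| ≤ c` for all `h ≤ 0`, `σ ∈ O_h`, all interpolation parameters.
[cite: BenfattoGiulianiMastropietro2003, §7.1 Lemma 7.3 (A1.13) p.26 (L114–123)] -/
theorem exists_box_rescaledWSymbolD (hm : 0 < m) (he : 0 < e₀) (heμ : e₀ < μ) :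
    ∃ c : ℝ, 0 < c ∧ ∀ (n σ n₀ : ℕ) {n₁ n₂ : ℕ} (tv : Fin n₁ → ℝ) (sv : Fin n₂ → ℝ), σ < sectorCount n →
      ∀ t : MomSpace, rescaledWSymbolD m μ e₀ n σ n₀ tv sv t ≠ 0 → |t 0| ≤ e₀ ∧ |t 1| ≤ c ∧ |t 2| ≤ c := by
  obtain ⟨c, hc, hbox⟩ := (jellium_dispersionHyp hm he heμ).exists_box_rescaledWSymbol
  refine ⟨c, hc, fun n σ n₀ n₁ n₂ tv sv hσ t ht => hbox n σ n₀ 0 0 hσ t ?_⟩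
  rw [rescaledWSymbolD_apply] at ht
  exact left_ne_zero_of_mul ht

/-- **Derivatives of a slice are bounded by the full derivatives** (generic parameter space `P`):
`‖D^k(F(p, ·))(t)‖ ≤ ‖D^k F (p, t)‖`. [folklore] -/
private theorem norm_iteratedFDeriv_sliceP_le {P : Type*} [NormedAddCommGroup P] [NormedSpace ℝ P]
    {F : P × MomSpace → ℂ} (hF : ContDiff ℝ ∞ F) (p : P) (k : ℕ) (t : MomSpace) :
    ‖iteratedFDeriv ℝ k (fun t => F (p, t)) t‖ ≤ ‖iteratedFDeriv ℝ k F (p, t)‖ := by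
  set g : P × MomSpace → ℂ := fun q => F (q + (p, 0)) with hg
  have hgc : ContDiff ℝ ∞ g := hF.comp (contDiff_id.add contDiff_const)
  have hcomp : (fun t => F (p, t)) = g ∘ (ContinuousLinearMap.inr ℝ P MomSpace) := by
    funext t; simp [hg]
  rw [hcomp, ContinuousLinearMap.iteratedFDeriv_comp_right _ hgc _ (by exact_mod_cast le_top)]
  refine (ContinuousMultilinearMap.norm_compContinuousLinearMap_le _ _).trans ?_
  have hinr : ∏ _i : Fin k, ‖ContinuousLinearMap.inr ℝ P MomSpace‖ ≤ 1 :=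
    Finset.prod_le_one (fun _ _ => norm_nonneg _) fun _ _ => ContinuousLinearMap.norm_inr_le_one ℝ P MomSpace
  have hshift : iteratedFDeriv ℝ k g (ContinuousLinearMap.inr ℝ P MomSpace t) = iteratedFDeriv ℝ k F (p, t) := by
    rw [hg, iteratedFDeriv_comp_add_right]
    congr 1
    simp
  rw [hshift]
  exact mul_le_of_le_one_right (norm_nonneg _) hinr

/-- **Uniform derivative bounds of the rescaled `D`-weighted symbols** — uniform in the scale `h ≤ 0`, the sector
`σ ∈ O_h` AND the interpolation parameters `t_j, s_j ∈ [0,1]` («`C_{N,m}`» of Lemma 6.1): for every order `k`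
there is `B ≥ 0` with `‖D^k R^D(t)‖ ≤ scaleFactorD · B` (continuity of `D^k Ψ^D` on the compact
`[0,2π] × [0,1] × [0,1]^{n₁} × [0,1]^{n₂} × box`). [cite: BenfattoGiulianiMastropietro2003, §6 Lemma 6.1 (7.11) p.25 (L116–127) and §7.2 p.27 (L28–52)] -/
theorem exists_norm_iteratedFDeriv_rescaledWSymbolD_le (hm : 0 < m) (he : 0 < e₀) (heμ : e₀ < μ) {r : ℝ}
    (hr : 0 < r) {χ : (Fin 2 → ℝ) → ℝ} (hχs : ContDiff ℝ ∞ χ) (hχ1 : ∀ k ∈ shell (jelliumRadius m μ) e₀, χ k = 1)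
    (hχr : ∀ k, χ k ≠ 0 → 2 * r ≤ ‖momToComplex k‖)
    (hχε : ∀ k, χ k ≠ 0 → k ∉ shell (jelliumRadius m μ) e₀ → e₀ < |jelliumDispersion m k - μ|)
    (n₀ n₁ n₂ k : ℕ) :
    ∃ B : ℝ, 0 ≤ B ∧ ∀ (n σ : ℕ), σ < sectorCount n → ∀ (tv : Fin n₁ → ℝ) (sv : Fin n₂ → ℝ),
      (∀ j, tv j ∈ Icc (0 : ℝ) 1) → (∀ j, sv j ∈ Icc (0 : ℝ) 1) → ∀ t : MomSpace,
        ‖iteratedFDeriv ℝ k (rescaledWSymbolD m μ e₀ n σ n₀ tv sv) t‖ ≤ scaleFactorD n n₀ n₁ n₂ * B := by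
  obtain ⟨c, hc, hbox⟩ := exists_box_rescaledWSymbolD (m := m) hm he heμ
  set P : Type := (ℝ × ℝ) × ((Fin n₁ → ℝ) × (Fin n₂ → ℝ))
  set Q : Set P := (Icc 0 (2 * π) ×ˢ Icc 0 1) ×ˢ (Icc 0 1 ×ˢ Icc 0 1) with hQ
  set T : Set MomSpace := {t | |t 0| ≤ e₀ ∧ |t 1| ≤ c ∧ |t 2| ≤ c} with hT
  have hK : IsCompact (Q ×ˢ T) :=
    ((isCompact_Icc.prod isCompact_Icc).prod (isCompact_Icc.prod isCompact_Icc)).prod (isCompact_momBox _ _ _)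
  have hF := contDiff_masterDL hm he heμ hr hχs n₀ n₁ n₂
  have hcont : ContinuousOn (fun q : P × MomSpace => iteratedFDeriv ℝ k (masterDL m μ e₀ r χ n₀ n₁ n₂) q) (Q ×ˢ T) :=
    (hF.continuous_iteratedFDeriv (by exact_mod_cast le_top)).continuousOn
  obtain ⟨B, hB⟩ := hK.exists_bound_of_continuousOn hcont
  refine ⟨max B 0, le_max_right _ _, fun n σ hσ tv sv htv hsv t => ?_⟩
  set θ₀ : ℝ := sectorCenter n σ with hθ₀
  set s : ℝ := (2 : ℝ) ^ (-(n : ℤ)) with hs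
  have hSF := scaleFactorD_pos n n₀ n₁ n₂
  have hp : (((θ₀, s), (tv, sv)) : P) ∈ Q := by
    refine ⟨⟨sectorCenter_mem_Icc hσ, (zpow_pos (by norm_num) _).le, zpow_le_one_of_nonpos₀ (by norm_num) (by simp)⟩,
      ⟨fun j => (htv j).1, fun j => (htv j).2⟩, ⟨fun j => (hsv j).1, fun j => (hsv j).2⟩⟩
  have heq := rescaledWSymbolD_eq_smul_masterDL hm he heμ hr hχ1 hχr hχε n σ n₀ htv hsv
  have hslice : ContDiff ℝ ∞ fun t : MomSpace => masterDL m μ e₀ r χ n₀ n₁ n₂ (((θ₀, s), (tv, sv)), t) :=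
    hF.comp (contDiff_const.prodMk contDiff_id)
  have hder : iteratedFDeriv ℝ k (rescaledWSymbolD m μ e₀ n σ n₀ tv sv) t =
      ((scaleFactorD n n₀ n₁ n₂ : ℝ) : ℂ) •
        iteratedFDeriv ℝ k (fun t : MomSpace => masterDL m μ e₀ r χ n₀ n₁ n₂ (((θ₀, s), (tv, sv)), t)) t := by
    rw [heq]
    exact iteratedFDeriv_const_smul_apply' ((hslice.of_le (by exact_mod_cast le_top)).contDiffAt)
  by_cases ht : t ∈ T
  · rw [hder, norm_smul, Complex.norm_real, Real.norm_eq_abs, abs_of_pos hSF]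
    refine mul_le_mul_of_nonneg_left ?_ hSF.le
    exact ((norm_iteratedFDeriv_sliceP_le hF _ k t).trans (hB _ (mk_mem_prod hp ht))).trans (le_max_left _ _)
  · have hsupp : tsupport (rescaledWSymbolD m μ e₀ n σ n₀ tv sv) ⊆ T := by
      refine closure_minimal (fun v hv => ?_) (isCompact_momBox _ _ _).isClosed
      exact hbox n σ n₀ tv sv hσ v hv
    have h0 : iteratedFDeriv ℝ k (rescaledWSymbolD m μ e₀ n σ n₀ tv sv) t = 0 := by
      by_contra hne
      exact ht (hsupp (support_iteratedFDeriv_subset k (Function.mem_support.2 hne)))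
    rw [h0, norm_zero]
    positivity

/-- **Smoothness of the rescaled `D`-weighted symbol** (for `t_j, s_j ∈ [0,1]`). [cite: BenfattoGiulianiMastropietro2003, §7.2 p.27 (L28–52)] -/
theorem contDiff_rescaledWSymbolD (hm : 0 < m) (he : 0 < e₀) (heμ : e₀ < μ) {r : ℝ} (hr : 0 < r)
    {χ : (Fin 2 → ℝ) → ℝ} (hχs : ContDiff ℝ ∞ χ) (hχ1 : ∀ k ∈ shell (jelliumRadius m μ) e₀, χ k = 1)
    (hχr : ∀ k, χ k ≠ 0 → 2 * r ≤ ‖momToComplex k‖)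
    (hχε : ∀ k, χ k ≠ 0 → k ∉ shell (jelliumRadius m μ) e₀ → e₀ < |jelliumDispersion m k - μ|)
    (n σ n₀ : ℕ) {n₁ n₂ : ℕ} {tv : Fin n₁ → ℝ} {sv : Fin n₂ → ℝ} (htv : ∀ j, tv j ∈ Icc (0 : ℝ) 1)
    (hsv : ∀ j, sv j ∈ Icc (0 : ℝ) 1) :
    ContDiff ℝ ∞ (rescaledWSymbolD m μ e₀ n σ n₀ tv sv) := by
  rw [rescaledWSymbolD_eq_smul_masterDL hm he heμ hr hχ1 hχr hχε n σ n₀ htv hsv]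
  exact ((contDiff_masterDL hm he heμ hr hχs n₀ n₁ n₂).comp (contDiff_const.prodMk contDiff_id)).const_smul _

end Symbol


variable {m μ e₀ : ℝ}

/-! ### §A. `D₁^{n₁}D₂^{n₂}g^{(h)}_ω` in the frame `x⃗ = x₁e⃗_r + x₂e⃗_t` is an oscillatory integral of `S^D` -/

/-- **F3c's `jelliumPropagatorD` at `x⃗ = x₁e⃗_r(θ_{h,ω}) + x₂e⃗_t(θ_{h,ω})` is the oscillatory integral
`Φ_{(2π)^{-3}S^D}`** with phases `k₀, k'₁, k'₂` (`k'₁ = (k⃗ − p_F e⃗_r)·e⃗_r`, `k'₂ = (k⃗ − p_F e⃗_r)·e⃗_t`, p.25 L45–49).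
[cite: BenfattoGiulianiMastropietro2003, §6 (7.5), (7.11) p.25 (L45–49, L80–90, L116–127)] -/
theorem jelliumPropagatorD_frame_eq_oscInt (hm : 0 < m) (hμ : 0 < μ) (e₀ : ℝ) (n σ : ℕ) {n₁ n₂ : ℕ}
    (tv : Fin n₁ → ℝ) (sv : Fin n₂ → ℝ) (x₀ x₁ x₂ : ℝ) :
    jelliumPropagatorD m μ e₀ n σ tv sv x₀ (x₁ • dir (sectorCenter n σ) + x₂ • tdir (sectorCenter n σ)) =
      oscInt (fun p => p.1) (fun p => frameCoord₁ (jelliumRadius m μ) (sectorCenter n σ) p.2)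
        (fun p => frameCoord₂ (jelliumRadius m μ) (sectorCenter n σ) p.2)
        (fun p => invTwoPiCube * wSymbolD m μ e₀ n σ 0 tv sv p) x₀ x₁ x₂ := by
  unfold jelliumPropagatorD oscInt invTwoPiCube
  rw [← integral_const_mul]
  congr 1; funext p
  have hphase : p.1 * x₀ + ∑ i : Fin 2, (p.2 i - jelliumFermiMomentum m μ * dir (sectorCenter n σ) i) *
        (x₁ • dir (sectorCenter n σ) + x₂ • tdir (sectorCenter n σ)) i =
      p.1 * x₀ + frameCoord₁ (jelliumRadius m μ) (sectorCenter n σ) p.2 * x₁ +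
        frameCoord₂ (jelliumRadius m μ) (sectorCenter n σ) p.2 * x₂ := by
    rw [frameCoord₁_jellium hm hμ, frameCoord₂_jellium hm hμ]
    simp only [dotProduct, Fin.sum_univ_two, Pi.add_apply, Pi.smul_apply, Pi.sub_apply, smul_eq_mul]
    ring
  rw [hphase]
  simp only [wSymbolD, pow_zero, one_mul]
  ring

/-- **`∂₀^{n₀}` under the integral**: once `S^D_{n₀ = 0}` is continuous with compact support,
`∂₀^{n₀} D₁^{n₁}D₂^{n₂} g^{(h)}_ω(x₀, x₁e⃗_r + x₂e⃗_t) = Φ_{(2π)^{-3}S^D_{n₀}}(x₀,x₁,x₂)`.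
[cite: BenfattoGiulianiMastropietro2003, §6 Lemma 6.1 (7.11) p.25 (L116–127) and §7.2 p.27 (L28–52)] -/
theorem iteratedDeriv_jelliumPropagatorD_frame (hm : 0 < m) (hμ : 0 < μ) (e₀ : ℝ) (n σ n₀ : ℕ) {n₁ n₂ : ℕ}
    (tv : Fin n₁ → ℝ) (sv : Fin n₂ → ℝ)
    (hW : Continuous fun p : Phase => wSymbolD m μ e₀ n σ 0 tv sv p)
    (hWs : HasCompactSupport fun p : Phase => wSymbolD m μ e₀ n σ 0 tv sv p) (x₀ x₁ x₂ : ℝ) :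
    iteratedDeriv n₀ (fun τ => jelliumPropagatorD m μ e₀ n σ tv sv τ
        (x₁ • dir (sectorCenter n σ) + x₂ • tdir (sectorCenter n σ))) x₀ =
      oscInt (fun p => p.1) (fun p => frameCoord₁ (jelliumRadius m μ) (sectorCenter n σ) p.2)
        (fun p => frameCoord₂ (jelliumRadius m μ) (sectorCenter n σ) p.2)
        (fun p => invTwoPiCube * wSymbolD m μ e₀ n σ n₀ tv sv p) x₀ x₁ x₂ := by
  have hfun : (fun τ => jelliumPropagatorD m μ e₀ n σ tv sv τ
      (x₁ • dir (sectorCenter n σ) + x₂ • tdir (sectorCenter n σ))) = fun τ =>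
      oscInt (fun p => p.1) (fun p => frameCoord₁ (jelliumRadius m μ) (sectorCenter n σ) p.2)
        (fun p => frameCoord₂ (jelliumRadius m μ) (sectorCenter n σ) p.2)
        (fun p => invTwoPiCube * wSymbolD m μ e₀ n σ 0 tv sv p) τ x₁ x₂ := by
    funext τ; exact jelliumPropagatorD_frame_eq_oscInt hm hμ e₀ n σ tv sv τ x₁ x₂
  have hWc : Continuous fun p : Phase => invTwoPiCube * wSymbolD m μ e₀ n σ 0 tv sv p := continuous_const.mul hW
  have hWcs : HasCompactSupport fun p : Phase => invTwoPiCube * wSymbolD m μ e₀ n σ 0 tv sv p := hWs.mul_left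
  rw [hfun, iteratedDeriv_oscInt continuous_fst (continuous_frameCoord₁ _ _) (continuous_frameCoord₂ _ _) n₀ hWc
    hWcs x₀ x₁ x₂]
  unfold oscInt
  congr 1; funext p
  simp only [wSymbolD, pow_zero, one_mul]
  ring

/-! ### §B. The anisotropic change of variables for `S^D` -/

/-- **`S^D` is the rescaled `R^D` in the chart**: `(cS^D) ∘ split = (cR^D) ∘ A⁻¹ ∘ (· − q_F)` with the chart `A` of part
3 of Lemma 2.1's proof for the jellium frame. [cite: BenfattoGiulianiMastropietro2003, §7.2 p.27 (L28–52)] -/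
theorem wSymbolDE_eq_comp (hm : 0 < m) (he : 0 < e₀) (heμ : e₀ < μ) (c : ℂ) (n σ n₀ : ℕ) {n₁ n₂ : ℕ}
    (tv : Fin n₁ → ℝ) (sv : Fin n₂ → ℝ) :
    (fun q : MomSpace => c * wSymbolD m μ e₀ n σ n₀ tv sv (splitMomentum q)) =
      ((fun t => c * rescaledWSymbolD m μ e₀ n σ n₀ tv sv t) ∘
          ((jellium_dispersionHyp hm he heμ).chartCLE (sectorCenter n σ) n).symm) ∘
        fun q => q + -basePt (jelliumRadius m μ) (sectorCenter n σ) := by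
  have hD := jellium_dispersionHyp hm he heμ
  funext q
  set t : MomSpace := (hD.chartCLE (sectorCenter n σ) n).symm (q + -basePt (jelliumRadius m μ) (sectorCenter n σ))
    with ht
  simp only [Function.comp_apply, rescaledWSymbolD]
  rw [← ht, ← hD.split_basePt_add_chartCLE (sectorCenter n σ) n t]
  congr 3
  rw [ht, ContinuousLinearEquiv.apply_symm_apply]
  abel

/-- Translations act on the Fourier transform by a phase (tree lemma, re-exported to fix the overload). [folklore] -/
private theorem norm_fourier_comp_add_right_mom (f : MomSpace → ℂ) (v₀ w : MomSpace) :
    ‖𝓕 (f ∘ fun v => v + v₀) w‖ = ‖𝓕 f w‖ :=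
  Literature.MathematicalPhysics.QuantumLattice.norm_fourier_comp_add_right f v₀ w

/-- **Decay transfer** for `S^D`: if `‖𝓕(cR^D)(y)‖ ≤ K(1+‖y‖)^{-N}` then
`|Φ_{cS^D}(x₀,x₁,x₂)| ≤ 4^{-n}4^{-n}2^{-n} · K · (1 + ‖(4^{-n}x₀, 4^{-n}x₁, 2^{-n}x₂)‖/(2π))^{-N}`.
[cite: BenfattoGiulianiMastropietro2003, §6 Lemma 6.1 (7.11) p.25 (L116–127) and §7.2 p.27 (L28–52)] -/
theorem norm_oscIntD_le_of_fourier_decay (hm : 0 < m) (he : 0 < e₀) (heμ : e₀ < μ) {c : ℂ} {n σ n₀ : ℕ}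
    {n₁ n₂ : ℕ} {tv : Fin n₁ → ℝ} {sv : Fin n₂ → ℝ} {K : ℝ} {N : ℕ}
    (hK : ∀ y, ‖𝓕 (fun t => c * rescaledWSymbolD m μ e₀ n σ n₀ tv sv t) y‖ ≤ K * ((1 + ‖y‖) ^ N)⁻¹)
    (x₀ x₁ x₂ : ℝ) :
    ‖oscInt (fun p => p.1) (fun p => frameCoord₁ (jelliumRadius m μ) (sectorCenter n σ) p.2)
        (fun p => frameCoord₂ (jelliumRadius m μ) (sectorCenter n σ) p.2)
        (fun p => c * wSymbolD m μ e₀ n σ n₀ tv sv p) x₀ x₁ x₂‖ ≤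
      ((4 : ℝ) ^ (-(n : ℤ)) * (4 : ℝ) ^ (-(n : ℤ)) * (2 : ℝ) ^ (-(n : ℤ))) *
        (K * ((1 + ‖WithLp.toLp 2 ![(4 : ℝ) ^ (-(n : ℤ)) * (x₀ / (2 * π)), (4 : ℝ) ^ (-(n : ℤ)) * (x₁ / (2 * π)),
          (2 : ℝ) ^ (-(n : ℤ)) * (x₂ / (2 * π))]‖) ^ N)⁻¹) := by
  have hD := jellium_dispersionHyp hm he heμ
  have hμ : 0 < μ := he.trans heμ
  have h0 : 0 < μ + 0 := by rw [add_zero]; exact hμ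
  set θ₀ : ℝ := sectorCenter n σ with hθ₀
  set u : ℝ → ℝ → ℝ := jelliumRadius m μ with hu
  set A := hD.chartCLE θ₀ n with hA
  have hx : x₁ • dir θ₀ + x₂ • tdir θ₀ = x₁ • unitNormal u θ₀ 0 + x₂ • unitTangent u θ₀ 0 := by
    rw [hu, unitNormal_jelliumRadius hm h0, unitTangent_jelliumRadius hm h0]
  rw [oscInt_eq_fourier, norm_mul, show I * _ = ((x₁ * ∑ i : Fin 2, fermiPoint u θ₀ i * unitNormal u θ₀ 0 i +
      x₂ * ∑ i : Fin 2, fermiPoint u θ₀ i * unitTangent u θ₀ 0 i : ℝ) : ℂ) * I by ring,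
    Complex.norm_exp_ofReal_mul_I, one_mul, wSymbolDE_eq_comp hm he heμ c n σ n₀ tv sv,
    norm_fourier_comp_add_right_mom]
  have h := norm_fourier_comp_continuousLinearEquiv_le A.symm hK
    (dualPt x₀ (x₁ • unitNormal u θ₀ 0 + x₂ • unitTangent u θ₀ 0))
  rw [ContinuousLinearEquiv.symm_symm, hD.adjoint_chartCLE, hD.chartAdj_dualPt] at h
  refine h.trans (le_of_eq ?_)
  have hdet := hD.det_chartCLE_symm θ₀ n
  rw [← hA] at hdet
  have hpos : 0 < (4 : ℝ) ^ (-(n : ℤ)) * (4 : ℝ) ^ (-(n : ℤ)) * (2 : ℝ) ^ (-(n : ℤ)) := by positivity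
  have key : |(LinearMap.det ((A.symm : MomSpace ≃ₗ[ℝ] MomSpace) : MomSpace →ₗ[ℝ] MomSpace))⁻¹| =
      (4 : ℝ) ^ (-(n : ℤ)) * (4 : ℝ) ^ (-(n : ℤ)) * (2 : ℝ) ^ (-(n : ℤ)) := by
    rw [hdet, inv_inv, abs_of_pos hpos]
  exact congrArg₂ (· * ·) key rfl

/-! ### §C. Assembly: Lemma 6.1 -/

/-- **`S^D` is continuous with compact support** on `ℝ × ℝ²` (for `t_j, s_j ∈ [0,1]`): the smooth, box-supported
`R^D` read through the affine chart. [cite: BenfattoGiulianiMastropietro2003, §7.2 p.27 (L28–52)] -/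
theorem continuous_hasCompactSupport_wSymbolD (hm : 0 < m) (he : 0 < e₀) (heμ : e₀ < μ) {r : ℝ} (hr : 0 < r)
    {χ : (Fin 2 → ℝ) → ℝ} (hχs : ContDiff ℝ ∞ χ) (hχ1 : ∀ k ∈ shell (jelliumRadius m μ) e₀, χ k = 1)
    (hχr : ∀ k, χ k ≠ 0 → 2 * r ≤ ‖momToComplex k‖)
    (hχε : ∀ k, χ k ≠ 0 → k ∉ shell (jelliumRadius m μ) e₀ → e₀ < |jelliumDispersion m k - μ|)
    (n σ n₀ : ℕ) {n₁ n₂ : ℕ} {tv : Fin n₁ → ℝ} {sv : Fin n₂ → ℝ} (htv : ∀ j, tv j ∈ Icc (0 : ℝ) 1)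
    (hsv : ∀ j, sv j ∈ Icc (0 : ℝ) 1) (hσ : σ < sectorCount n) :
    Continuous (fun p : Phase => wSymbolD m μ e₀ n σ n₀ tv sv p) ∧
      HasCompactSupport (fun p : Phase => wSymbolD m μ e₀ n σ n₀ tv sv p) := by
  have hD := jellium_dispersionHyp hm he heμ
  set R := rescaledWSymbolD m μ e₀ n σ n₀ tv sv with hR
  set A := hD.chartCLE (sectorCenter n σ) n with hA
  set G : MomSpace → ℂ := (R ∘ A.symm) ∘ fun q => q + -basePt (jelliumRadius m μ) (sectorCenter n σ) with hG
  have hcomp := wSymbolDE_eq_comp hm he heμ 1 n σ n₀ tv sv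
  simp only [one_mul] at hcomp
  have hWp : ∀ p : Phase, wSymbolD m μ e₀ n σ n₀ tv sv p = G (embPhase p) := by
    intro p
    have := congrFun hcomp (embPhase p)
    rw [splitMomentum_embPhase] at this
    exact this
  have hW : (fun p : Phase => wSymbolD m μ e₀ n σ n₀ tv sv p) = G ∘ embPhase := by
    funext p; exact hWp p
  have hRc : Continuous R := (contDiff_rescaledWSymbolD hm he heμ hr hχs hχ1 hχr hχε n σ n₀ htv hsv).continuous
  have hGc : Continuous G := (hRc.comp A.symm.continuous).comp (continuous_id.add continuous_const)
  refine ⟨by rw [hW]; exact hGc.comp continuous_embPhase, ?_⟩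
  obtain ⟨c, hc, hbox⟩ := exists_box_rescaledWSymbolD (m := m) hm he heμ
  set T : Set MomSpace := {t | |t 0| ≤ e₀ ∧ |t 1| ≤ c ∧ |t 2| ≤ c} with hT
  have hTc : IsCompact T := isCompact_momBox _ _ _
  set K : Set Phase := splitMomentum '' ((fun t => basePt (jelliumRadius m μ) (sectorCenter n σ) + A t) '' T) with hK
  have hKc : IsCompact K :=
    ((hTc.image (continuous_const.add A.continuous)).image continuous_splitMomentum)
  refine HasCompactSupport.intro hKc fun p hp => ?_
  by_contra hne
  apply hp
  set t : MomSpace := A.symm (embPhase p + -basePt (jelliumRadius m μ) (sectorCenter n σ)) with ht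
  have hpt : p = splitMomentum (basePt (jelliumRadius m μ) (sectorCenter n σ) + A t) := by
    rw [ht, ContinuousLinearEquiv.apply_symm_apply, ← add_assoc, add_neg_cancel_comm]
    exact (splitMomentum_embPhase p).symm
  have hRt : R t ≠ 0 := by
    rw [hWp p] at hne
    exact hne
  exact ⟨basePt (jelliumRadius m μ) (sectorCenter n σ) + A t, ⟨t, hbox n σ n₀ tv sv hσ t hRt, rfl⟩, hpt.symm⟩

/-- **The scales of (7.11)**: `γ^hγ^hγ^{h/2} · scaleFactorD = γ^{h(3/2+n₀+n₁+3n₂/2)}`, `γ = 4`, `h = −n`.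
[cite: BenfattoGiulianiMastropietro2003, §6 Lemma 6.1 (7.11) p.25 (L116–127)] -/
theorem det_mul_scaleFactorD (n n₀ n₁ n₂ : ℕ) :
    (4 : ℝ) ^ (-(n : ℤ)) * (4 : ℝ) ^ (-(n : ℤ)) * (2 : ℝ) ^ (-(n : ℤ)) * scaleFactorD n n₀ n₁ n₂ =
      (4 : ℝ) ^ (-((n : ℝ) * (3 / 2 + (n₀ : ℝ) + (n₁ : ℝ) + 3 / 2 * (n₂ : ℝ)))) := by
  have hA : (4 : ℝ) ^ (-(n : ℤ)) * (4 : ℝ) ^ (-(n : ℤ)) * (2 : ℝ) ^ (-(n : ℤ)) * scaleFactorD n n₀ n₁ n₂ =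
      ((4 : ℝ) ^ (-(n : ℤ)) * (4 : ℝ) ^ (-(n : ℤ)) * (2 : ℝ) ^ (-(n : ℤ)) * scaleFactor n n₀ 0 0) *
        ((((2 : ℝ) ^ (-(n : ℤ))) ^ 2) ^ n₁ * (((2 : ℝ) ^ (-(n : ℤ))) ^ 3) ^ n₂) := by
    rw [scaleFactorD]; ring
  rw [hA, det_mul_scaleFactor n n₀ 0 0]
  have hE : ((((2 : ℝ) ^ (-(n : ℤ))) ^ 2) ^ n₁ * (((2 : ℝ) ^ (-(n : ℤ))) ^ 3) ^ n₂) =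
      (2 : ℝ) ^ (-((n : ℤ) * (2 * n₁ + 3 * n₂))) := by
    rw [← pow_mul, ← pow_mul, ← pow_add, ← zpow_natCast, ← zpow_mul]
    congr 1; push_cast; ring
  have hE' : (2 : ℝ) ^ (-((n : ℤ) * (2 * n₁ + 3 * n₂))) = (4 : ℝ) ^ (-((n : ℝ) * ((n₁ : ℝ) + 3 / 2 * (n₂ : ℝ)))) := by
    rw [show (4 : ℝ) = (2 : ℝ) ^ (2 : ℝ) by norm_num, ← Real.rpow_mul (by norm_num), ← Real.rpow_intCast]
    congr 1; push_cast; ring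
  rw [hE, hE', ← Real.rpow_add (by norm_num : (0 : ℝ) < 4)]
  congr 1; push_cast; ring

/-- The printed denominator of (7.11) against the one of (3.22) at order `2N`: with
`Q = (4^{-n}x₀)² + (4^{-n}x₁)² + (2^{-n}x₂)²` and `S = 4^{-n}|x₀| + 4^{-n}|x₁| + 2^{-n}|x₂|`, `Q ≤ S²`, so
`1 + Q^N ≤ 1 + S^{2N}`. [cite: BenfattoGiulianiMastropietro2003, §6 Lemma 6.1 (7.11) p.25 (L116–127)] -/
theorem one_add_sq_pow_le (n N : ℕ) (x₀ x₁ x₂ : ℝ) :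
    1 + (((4 : ℝ) ^ (-(n : ℤ)) * x₀) ^ 2 + ((4 : ℝ) ^ (-(n : ℤ)) * x₁) ^ 2 + ((2 : ℝ) ^ (-(n : ℤ)) * x₂) ^ 2) ^ N ≤
      1 + ((4 : ℝ) ^ (-(n : ℤ)) * |x₀| + (4 : ℝ) ^ (-(n : ℤ)) * |x₁| + (2 : ℝ) ^ (-(n : ℤ)) * |x₂|) ^ (2 * N) := by
  have h4 : 0 < (4 : ℝ) ^ (-(n : ℤ)) := zpow_pos (by norm_num) _
  have h2 : 0 < (2 : ℝ) ^ (-(n : ℤ)) := zpow_pos (by norm_num) _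
  set a := (4 : ℝ) ^ (-(n : ℤ)) * |x₀| with ha
  set b := (4 : ℝ) ^ (-(n : ℤ)) * |x₁| with hb
  set c := (2 : ℝ) ^ (-(n : ℤ)) * |x₂| with hc
  have ha0 : 0 ≤ a := by positivity
  have hb0 : 0 ≤ b := by positivity
  have hc0 : 0 ≤ c := by positivity
  have hQ : ((4 : ℝ) ^ (-(n : ℤ)) * x₀) ^ 2 + ((4 : ℝ) ^ (-(n : ℤ)) * x₁) ^ 2 + ((2 : ℝ) ^ (-(n : ℤ)) * x₂) ^ 2 =
      a ^ 2 + b ^ 2 + c ^ 2 := by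
    rw [ha, hb, hc, mul_pow, mul_pow, mul_pow, mul_pow, mul_pow, mul_pow, sq_abs, sq_abs, sq_abs]
  rw [hQ, pow_mul]
  have hle : a ^ 2 + b ^ 2 + c ^ 2 ≤ (a + b + c) ^ 2 := by nlinarith [mul_nonneg ha0 hb0, mul_nonneg hb0 hc0, mul_nonneg ha0 hc0]
  have := pow_le_pow_left₀ (by positivity) hle N
  linarith

/-- **BGM 2003 Lemma 6.1 [lm7.1], (7.11) — PROVED** (the discharge of F3c's named fact `lemma61_jelliumPropagatorDecay`):
for the jellium model (`ε(k⃗) = |k⃗|²/2m`, `m > 0`, `0 < e₀ < μ`) and all `N, n₀, n₁, n₂` there is `C > 0` with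
`|∂₀^{n₀} D₁^{n₁} D₂^{n₂} g^{(h)}_ω(x)| ≤ C γ^{h(3/2+n₀+n₁+3n₂/2)} / (1 + [(γ^hx₀)² + (γ^hx₁)² + (γ^{h/2}x₂)²]^N)` for all
`h = −n ≤ 0`, `ω ∈ O_h`, `t_j, s_j ∈ [0,1]` and `x = (x₀, x₁e⃗_r(θ_{h,ω}) + x₂e⃗_t(θ_{h,ω}))` — «it is easy to prove the
following dimensional bound»: the jellium datum is in the class of §1.2 (part 1 §J), on a sector the multipliers of
`D₁(t)`, `D₂(t)` are `γ^h`, `γ^{3h/2}` times functions smooth in the anisotropic chart (§M), so the §7.2 machine of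
Lemma 2.1 (smooth master function on a compact parameter set, change of variables, `2N` integrations by parts)
applies verbatim. [cite: BenfattoGiulianiMastropietro2003, §6 Lemma 6.1 (7.11) p.25 (L114–136) and §7.2 p.27 (L28–52)] -/
theorem lemma61_jelliumPropagatorDecay_holds : lemma61_jelliumPropagatorDecay := by
  intro m μ e₀ hm he heμ N n₀ n₁ n₂
  have hμ : 0 < μ := he.trans heμ
  have hD := jellium_dispersionHyp hm he heμ
  obtain ⟨δ, r, hδ, hr, hχs, hχ1, hχr, hχε⟩ := hD.exists_shellBump
  -- uniform derivative bounds of the rescaled `D`-weighted symbols, up to order `2N`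
  choose B hB0 hB using fun k =>
    exists_norm_iteratedFDeriv_rescaledWSymbolD_le hm he heμ hr hχs hχ1 hχr hχε n₀ n₁ n₂ k
  set Bs : ℝ := ∑ k ∈ Finset.range (2 * N + 1), B k with hBs
  have hBs0 : 0 ≤ Bs := Finset.sum_nonneg fun k _ => hB0 k
  have hBle : ∀ k ≤ 2 * N, B k ≤ Bs := fun k hk =>
    Finset.single_le_sum (fun k _ => hB0 k) (Finset.mem_range.2 (Nat.lt_succ_of_le hk))
  -- the box and its volume
  obtain ⟨c, hc, hbox⟩ := exists_box_rescaledWSymbolD (m := m) hm he heμ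
  set T : Set MomSpace := {t | |t 0| ≤ e₀ ∧ |t 1| ≤ c ∧ |t 2| ≤ c} with hT
  have hTc : IsCompact T := isCompact_momBox _ _ _
  have hTfin : volume T < ⊤ := hTc.measure_lt_top
  set vol : ℝ := (volume T).toReal with hvol
  have hvol0 : 0 ≤ vol := ENNReal.toReal_nonneg
  set c3 : ℝ := ((2 * π) ^ 3)⁻¹ with hc3
  have hc30 : 0 < c3 := by positivity
  set C₀ : ℝ := 2 ^ (2 * N) * (c3 * Bs * vol) * (1 + (6 * π) ^ (2 * N)) with hC₀
  have hC₀0 : 0 ≤ C₀ := by positivity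
  refine ⟨C₀ + 1, by positivity, fun n σ hσ tv sv htv hsv x₀ x₁ x₂ => ?_⟩
  -- the rescaled `D`-weighted symbol of this scale/sector/parameters, times `(2π)^{-3}`
  set R := rescaledWSymbolD m μ e₀ n σ n₀ tv sv with hRdef
  set f : MomSpace → ℂ := fun t => invTwoPiCube * R t with hf
  have hRc : ContDiff ℝ ∞ R := contDiff_rescaledWSymbolD hm he heμ hr hχs hχ1 hχr hχε n σ n₀ htv hsv
  have hfc : ContDiff ℝ ∞ f := contDiff_const.mul hRc
  have hsuppR : tsupport R ⊆ T :=
    closure_minimal (fun v hv => hbox n σ n₀ tv sv hσ v hv) hTc.isClosed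
  have hsuppf : tsupport f ⊆ T := tsupport_mul_subset_right.trans hsuppR
  have hfs : HasCompactSupport f := hTc.of_isClosed_subset (isClosed_tsupport _) hsuppf
  have hSF := scaleFactorD_pos n n₀ n₁ n₂
  have hM : ∀ k ≤ 2 * N, ∀ t, ‖iteratedFDeriv ℝ k f t‖ ≤ c3 * (scaleFactorD n n₀ n₁ n₂ * Bs) := by
    intro k hk t
    have hder : iteratedFDeriv ℝ k f t = invTwoPiCube • iteratedFDeriv ℝ k R t := by
      have : f = fun t => invTwoPiCube • R t := by funext t; rfl
      rw [this]
      exact iteratedFDeriv_const_smul_apply' ((hRc.of_le (by exact_mod_cast le_top)).contDiffAt)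
    rw [hder, norm_smul, norm_invTwoPiCube]
    refine mul_le_mul_of_nonneg_left ?_ hc30.le
    exact (hB k n σ hσ tv sv htv hsv t).trans (mul_le_mul_of_nonneg_left (hBle k hk) hSF.le)
  have hvolle : (volume (tsupport f)).toReal ≤ vol := ENNReal.toReal_mono hTfin.ne (measure_mono hsuppf)
  have hK : ∀ y, ‖𝓕 f y‖ ≤ 2 ^ (2 * N) * (c3 * (scaleFactorD n n₀ n₁ n₂ * Bs) * vol) * ((1 + ‖y‖) ^ (2 * N))⁻¹ :=
    fun y => norm_fourier_le_of_iteratedFDeriv_le hfc hfs hM hvolle y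
  -- Step A: `∂₀^{n₀}` under the integral
  obtain ⟨hWc, hWs⟩ := continuous_hasCompactSupport_wSymbolD hm he heμ hr hχs hχ1 hχr hχε n σ 0 htv hsv hσ
  rw [iteratedDeriv_jelliumPropagatorD_frame hm hμ e₀ n σ n₀ tv sv hWc hWs x₀ x₁ x₂]
  -- Step B/C: the change of variables and the Fourier decay
  have hdec := norm_oscIntD_le_of_fourier_decay hm he heμ (c := invTwoPiCube) (n := n) (σ := σ) (n₀ := n₀)
    (tv := tv) (sv := sv) hK x₀ x₁ x₂
  refine hdec.trans ?_
  -- numerics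
  set S : ℝ := (4 : ℝ) ^ (-(n : ℤ)) * |x₀| + (4 : ℝ) ^ (-(n : ℤ)) * |x₁| + (2 : ℝ) ^ (-(n : ℤ)) * |x₂| with hS
  set Q : ℝ := ((4 : ℝ) ^ (-(n : ℤ)) * x₀) ^ 2 + ((4 : ℝ) ^ (-(n : ℤ)) * x₁) ^ 2 + ((2 : ℝ) ^ (-(n : ℤ)) * x₂) ^ 2
    with hQ
  set y : MomSpace := WithLp.toLp 2 ![(4 : ℝ) ^ (-(n : ℤ)) * (x₀ / (2 * π)), (4 : ℝ) ^ (-(n : ℤ)) * (x₁ / (2 * π)),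
    (2 : ℝ) ^ (-(n : ℤ)) * (x₂ / (2 * π))] with hy
  have hS0 : 0 ≤ S := by positivity
  have hQ0 : 0 ≤ Q := by positivity
  have hden : 0 < 1 + S ^ (2 * N) := by positivity
  have hdenQ : 0 < 1 + Q ^ N := by positivity
  have hyN : 0 < (1 + ‖y‖) ^ (2 * N) := by positivity
  have hcmp : 1 + S ^ (2 * N) ≤ (1 + (6 * π) ^ (2 * N)) * (1 + ‖y‖) ^ (2 * N) := one_add_pow_le n (2 * N) x₀ x₁ x₂
  have hQS : 1 + Q ^ N ≤ 1 + S ^ (2 * N) := one_add_sq_pow_le n N x₀ x₁ x₂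
  have hscale := det_mul_scaleFactorD n n₀ n₁ n₂
  set P : ℝ := (4 : ℝ) ^ (-((n : ℝ) * (3 / 2 + (n₀ : ℝ) + (n₁ : ℝ) + 3 / 2 * (n₂ : ℝ)))) with hP
  have hP0 : 0 < P := Real.rpow_pos_of_pos (by norm_num) _
  have hlhs : (4 : ℝ) ^ (-(n : ℤ)) * (4 : ℝ) ^ (-(n : ℤ)) * (2 : ℝ) ^ (-(n : ℤ)) *
      (2 ^ (2 * N) * (c3 * (scaleFactorD n n₀ n₁ n₂ * Bs) * vol) * ((1 + ‖y‖) ^ (2 * N))⁻¹) =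
      2 ^ (2 * N) * (c3 * Bs * vol) * P * ((1 + ‖y‖) ^ (2 * N))⁻¹ := by
    rw [← hscale]; ring
  rw [hlhs]
  have hinv : ((1 + ‖y‖) ^ (2 * N))⁻¹ ≤ (1 + (6 * π) ^ (2 * N)) / (1 + S ^ (2 * N)) := by
    rw [inv_le_iff_one_le_mul₀ hyN, div_mul_eq_mul_div, one_le_div hden]
    linarith
  have hA0 : 0 ≤ 2 ^ (2 * N) * (c3 * Bs * vol) * P := by positivity
  calc 2 ^ (2 * N) * (c3 * Bs * vol) * P * ((1 + ‖y‖) ^ (2 * N))⁻¹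
      ≤ 2 ^ (2 * N) * (c3 * Bs * vol) * P * ((1 + (6 * π) ^ (2 * N)) / (1 + S ^ (2 * N))) :=
        mul_le_mul_of_nonneg_left hinv hA0
    _ = C₀ * P / (1 + S ^ (2 * N)) := by rw [hC₀]; ring
    _ ≤ (C₀ + 1) * P / (1 + S ^ (2 * N)) := by
        refine div_le_div_of_nonneg_right ?_ hden.le
        exact mul_le_mul_of_nonneg_right (by linarith) hP0.le
    _ ≤ (C₀ + 1) * P / (1 + Q ^ N) :=
        div_le_div_of_nonneg_left (by positivity) hdenQ hQS

end BGM2003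

end Literature.MathematicalPhysics.QuantumLattice.FermiRG

end
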